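import Literature.NumberTheory.Sieve.PolymathGEHCutoffFibres
import Literature.NumberTheory.Sieve.PolymathGEHCutoffI
import Literature.NumberTheory.Sieve.PolymathBoundedGapsCert
import Mathlib.Tactic.Ring
import Mathlib.Tactic.Linarith
import HarnessLib

/-!
# Polymath 8b, Theorem 3.15: `Σ_i J_{i,1-ε}(F) ≥ J(F) = 9933190664926733/40587440947200 > 2 I(F)`

Trunk AntSieve, continuation of `PolymathGEHCutoffFibres.lean` and `PolymathGEHCutoffI.lean`
(D. H. J. Polymath, *Variants of the Selberg sieve, and bounded intervals containing many primes*,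
Res. Math. Sci. 1:12 (2014) = arXiv:1407.4897, Theorem 3.15, §7.4), toward the named fact
`Literature.NumberTheory.Sieve.weakDHL_three_two_of_GEH` (Theorem 3.2(xii)).

p. 33: "`J(F) = 6 ∫_{0<y<x, x+y<1-ε} (∫₀^{3/2-x-y} F dz)² dx dy = 6(J₁ + ⋯ + J₈)`"; p. 34: "`J(F) =
9933190664926733/40587440947200`", "`J(F)/I(F) = 2 + 286648173/4966595189139280`".  For the tree's
functionals (`polymathJ k r i F`, `polymathI k F` of `PolymathBoundedGaps.lean`, `r = 1 - ε = 3/4`)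
and the cutoff `F3` this file PROVES:

* `polymathJ_two_eq`, `polymathJ_zero_eq`, `polymathJ_one_eq` — the three `J_{i,3/4}(F3)` all equal
  `∫ 1_{J-region} m(t₀,t₁)²` (symmetry of `F3` pointwise, and `integral_comp_perm`), where `m` is the
  marginal of `PolymathGEHCutoffFibres.lean`; `integrable_Jintegrand` (bounded, strongly measurable
  by `StronglyMeasurable.integral_prod_right`);
* the eight boxes `Q_m × (0,1)` as `GCell`s with **exact integrals `J_m`** (`decide +kernel` applied
  to `M_{Q_m}²`), `box…_spec` (inside a box the fibre identity of the Fibres file applies),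
  disjointness, and the minorant `ℓ = Σ 1_{box_m} M_{Q_m}²` with `ℓ(t) + ℓ(t₁,t₀,t₂) ≤ 1_{J-region} m²`;
* `polymathJ_two_ge` : `J_{3,3/4}(F3) ≥ 2(J₁ + ⋯ + J₈)`, `sum_polymathJ_ge` :
  **`Σ_i J_{i,3/4}(F3) ≥ 9933190664926733/40587440947200`**, and with `polymathI_F3`:
  `two_mul_polymathI_lt_sum_polymathJ` : **`2 I(F3) < Σ_i J_{i,1-1/4}(F3)`** — the inequality of
  Theorem 3.15 (the exact margin is `J(F) - 2I(F) = 286648173/40587440947200 > 0`).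

Only a lower bound for `J` is proved (open boxes suffice); it is what Theorem 3.15 asserts.

## References

* [Polymath8b2014] D. H. J. Polymath, Res. Math. Sci. 1 (2014), Art. 12 = arXiv:1407.4897,
  §7.4 (pp. 33–34), Theorem 3.15.
-/

noncomputable section

open MeasureTheory Finset

namespace Literature.NumberTheory.Sieve

namespace GEHCutoff

/-! ### Coordinates: `Function.update` on `Fin 3`, the `J`-regions -/

/-- `update t 2 u = (t₀, t₁, u)`. [folklore] -/
theorem update_two (t : Fin 3 → ℝ) (u : ℝ) : Function.update t 2 u = ![t 0, t 1, u] := by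
  funext k; fin_cases k <;> simp

/-- `update t 0 u = (u, t₁, t₂)`. [folklore] -/
theorem update_zero (t : Fin 3 → ℝ) (u : ℝ) : Function.update t 0 u = ![u, t 1, t 2] := by
  funext k; fin_cases k <;> simp

/-- `update t 1 u = (t₀, u, t₂)`. [folklore] -/
theorem update_one (t : Fin 3 → ℝ) (u : ℝ) : Function.update t 1 u = ![t 0, u, t 2] := by
  funext k; fin_cases k <;> simp

/-- Quantifying over `Fin 3`. [folklore] -/
theorem forall_fin_three {P : Fin 3 → Prop} : (∀ j, P j) ↔ P 0 ∧ P 1 ∧ P 2 :=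
  ⟨fun h => ⟨h 0, h 1, h 2⟩, fun h j => by
    fin_cases j
    · exact h.1
    · exact h.2.1
    · exact h.2.2⟩

/-- `Σ_{j ≠ 2} t_j = t₀ + t₁`. [folklore] -/
theorem sum_erase_two (t : Fin 3 → ℝ) : ∑ j ∈ Finset.univ.erase (2 : Fin 3), t j = t 0 + t 1 := by
  rw [Finset.sum_erase_eq_sub (Finset.mem_univ _), Fin.sum_univ_three]; ring

/-- `Σ_{j ≠ 0} t_j = t₁ + t₂`. [folklore] -/
theorem sum_erase_zero (t : Fin 3 → ℝ) : ∑ j ∈ Finset.univ.erase (0 : Fin 3), t j = t 1 + t 2 := by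
  rw [Finset.sum_erase_eq_sub (Finset.mem_univ _), Fin.sum_univ_three]; ring

/-- `Σ_{j ≠ 1} t_j = t₀ + t₂`. [folklore] -/
theorem sum_erase_one (t : Fin 3 → ℝ) : ∑ j ∈ Finset.univ.erase (1 : Fin 3), t j = t 0 + t 2 := by
  rw [Finset.sum_erase_eq_sub (Finset.mem_univ _), Fin.sum_univ_three]; ring

/-- The region of `J_{3,r}` unfolded. [cite: Polymath8b2014, Theorem 3.12, definition of J_{i,1-ε}] -/
theorem mem_polymathJRegion_two {r : ℝ} {t : Fin 3 → ℝ} : t ∈ polymathJRegion 3 r 2 ↔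
    t 2 ≤ 1 ∧ (0 ≤ t 0 ∧ 0 ≤ t 1 ∧ 0 ≤ t 2) ∧ t 0 + t 1 ≤ r := by
  simp only [polymathJRegion, Set.mem_setOf_eq, sum_erase_two, forall_fin_three]

/-- The region of `J_{1,r}` unfolded. [cite: Polymath8b2014, Theorem 3.12, definition of J_{i,1-ε}] -/
theorem mem_polymathJRegion_zero {r : ℝ} {t : Fin 3 → ℝ} : t ∈ polymathJRegion 3 r 0 ↔
    t 0 ≤ 1 ∧ (0 ≤ t 0 ∧ 0 ≤ t 1 ∧ 0 ≤ t 2) ∧ t 1 + t 2 ≤ r := by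
  simp only [polymathJRegion, Set.mem_setOf_eq, sum_erase_zero, forall_fin_three]

/-- The region of `J_{2,r}` unfolded. [cite: Polymath8b2014, Theorem 3.12, definition of J_{i,1-ε}] -/
theorem mem_polymathJRegion_one {r : ℝ} {t : Fin 3 → ℝ} : t ∈ polymathJRegion 3 r 1 ↔
    t 1 ≤ 1 ∧ (0 ≤ t 0 ∧ 0 ≤ t 1 ∧ 0 ≤ t 2) ∧ t 0 + t 2 ≤ r := by
  simp only [polymathJRegion, Set.mem_setOf_eq, sum_erase_one, forall_fin_three]

/-! ### The marginal is symmetric; the inner integrals of the three `J_i` -/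

/-- **`m(y, x) = m(x, y)`** (symmetry of `F`). [cite: Polymath8b2014, Theorem 3.15] -/
theorem mfun_symm (x y : ℝ) : mfun y x = mfun x y := by
  unfold mfun
  congr 1
  funext u
  have := F3_swap01 ![x, y, u]
  simpa using this

/-- The inner integral of `J_{3}`. [cite: Polymath8b2014, Theorem 3.12, definition of J_{i,1-ε}] -/
theorem inner_two (t : Fin 3 → ℝ) : ∫ u in Set.Ioi 0, F3 (Function.update t 2 u) = mfun (t 0) (t 1) := by
  simp_rw [update_two]
  rfl

/-- The inner integral of `J_{1}` (symmetry of `F` in the first and last variables).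
[cite: Polymath8b2014, Theorem 3.12, definition of J_{i,1-ε}] -/
theorem inner_zero (t : Fin 3 → ℝ) : ∫ u in Set.Ioi 0, F3 (Function.update t 0 u) = mfun (t 2) (t 1) := by
  simp_rw [update_zero]
  unfold mfun
  congr 1
  funext u
  have := F3_swap02 ![t 2, t 1, u]
  simpa using this

/-- The inner integral of `J_{2}` (symmetry of `F` in the last two variables).
[cite: Polymath8b2014, Theorem 3.12, definition of J_{i,1-ε}] -/
theorem inner_one (t : Fin 3 → ℝ) : ∫ u in Set.Ioi 0, F3 (Function.update t 1 u) = mfun (t 0) (t 2) := by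
  simp_rw [update_one]
  unfold mfun
  congr 1
  funext u
  have := F3_swap12 ![t 0, t 2, u]
  simpa using this

/-- `J_{3,r}(F)` as an integral over `ℝ³` of an indicator. [cite: Polymath8b2014, Theorem 3.12, definition of J_{i,1-ε}] -/
theorem polymathJ_two_eq (r : ℝ) : polymathJ 3 r 2 F3 =
    ∫ t, (polymathJRegion 3 r 2).indicator (fun t => mfun (t 0) (t 1) ^ 2) t := by
  unfold polymathJ
  rw [MeasureTheory.integral_indicator (PolymathCert.measurableSet_polymathJRegion 3 r 2)]
  refine setIntegral_congr_fun (PolymathCert.measurableSet_polymathJRegion 3 r 2) fun t _ => ?_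
  simp only [inner_two]

/-- **`J_{1,r}(F) = J_{3,r}(F)`** for the symmetric cutoff (permuting coordinates).
[cite: Polymath8b2014, Theorem 3.15] -/
theorem polymathJ_zero_eq (r : ℝ) : polymathJ 3 r 0 F3 =
    ∫ t, (polymathJRegion 3 r 2).indicator (fun t => mfun (t 0) (t 1) ^ 2) t := by
  have step1 : polymathJ 3 r 0 F3 = ∫ t, (polymathJRegion 3 r 0).indicator (fun t => mfun (t 2) (t 1) ^ 2) t := by
    unfold polymathJ
    rw [MeasureTheory.integral_indicator (PolymathCert.measurableSet_polymathJRegion 3 r 0)]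
    refine setIntegral_congr_fun (PolymathCert.measurableSet_polymathJRegion 3 r 0) fun t _ => ?_
    simp only [inner_zero]
  rw [step1, ← integral_comp_perm (Equiv.swap 0 2) ((polymathJRegion 3 r 2).indicator fun t => mfun (t 0) (t 1) ^ 2)]
  refine integral_congr_ae (Filter.Eventually.of_forall fun t => ?_)
  simp only [rearr_210]
  by_cases ht : t 0 ≤ 1 ∧ (0 ≤ t 0 ∧ 0 ≤ t 1 ∧ 0 ≤ t 2) ∧ t 1 + t 2 ≤ r
  · rw [Set.indicator_of_mem (mem_polymathJRegion_zero.2 ht), Set.indicator_of_mem (mem_polymathJRegion_two.2 (by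
      simp only [Matrix.cons_val_zero, Matrix.cons_val_one, Matrix.cons_val_two, Matrix.head_cons, Matrix.tail_cons]
      obtain ⟨a, ⟨b, c, d⟩, e⟩ := ht
      exact ⟨a, ⟨d, c, b⟩, by linarith⟩))]
    simp
  · rw [Set.indicator_of_notMem (fun h => ht (mem_polymathJRegion_zero.1 h)), Set.indicator_of_notMem]
    intro h
    apply ht
    have h' := mem_polymathJRegion_two.1 h
    simp only [Matrix.cons_val_zero, Matrix.cons_val_one, Matrix.cons_val_two, Matrix.head_cons, Matrix.tail_cons] at h'
    obtain ⟨a, ⟨b, c, d⟩, e⟩ := h'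
    exact ⟨a, ⟨d, c, b⟩, by linarith⟩

/-- **`J_{2,r}(F) = J_{3,r}(F)`** for the symmetric cutoff. [cite: Polymath8b2014, Theorem 3.15] -/
theorem polymathJ_one_eq (r : ℝ) : polymathJ 3 r 1 F3 =
    ∫ t, (polymathJRegion 3 r 2).indicator (fun t => mfun (t 0) (t 1) ^ 2) t := by
  have step1 : polymathJ 3 r 1 F3 = ∫ t, (polymathJRegion 3 r 1).indicator (fun t => mfun (t 0) (t 2) ^ 2) t := by
    unfold polymathJ
    rw [MeasureTheory.integral_indicator (PolymathCert.measurableSet_polymathJRegion 3 r 1)]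
    refine setIntegral_congr_fun (PolymathCert.measurableSet_polymathJRegion 3 r 1) fun t _ => ?_
    simp only [inner_one]
  rw [step1, ← integral_comp_perm (Equiv.swap 1 2) ((polymathJRegion 3 r 2).indicator fun t => mfun (t 0) (t 1) ^ 2)]
  refine integral_congr_ae (Filter.Eventually.of_forall fun t => ?_)
  simp only [rearr_021]
  by_cases ht : t 1 ≤ 1 ∧ (0 ≤ t 0 ∧ 0 ≤ t 1 ∧ 0 ≤ t 2) ∧ t 0 + t 2 ≤ r
  · rw [Set.indicator_of_mem (mem_polymathJRegion_one.2 ht), Set.indicator_of_mem (mem_polymathJRegion_two.2 (by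
      simp only [Matrix.cons_val_zero, Matrix.cons_val_one, Matrix.cons_val_two, Matrix.head_cons, Matrix.tail_cons]
      obtain ⟨a, ⟨b, c, d⟩, e⟩ := ht
      exact ⟨a, ⟨b, d, c⟩, by linarith⟩))]
    simp
  · rw [Set.indicator_of_notMem (fun h => ht (mem_polymathJRegion_one.1 h)), Set.indicator_of_notMem]
    intro h
    apply ht
    have h' := mem_polymathJRegion_two.1 h
    simp only [Matrix.cons_val_zero, Matrix.cons_val_one, Matrix.cons_val_two, Matrix.head_cons, Matrix.tail_cons] at h'
    obtain ⟨a, ⟨b, c, d⟩, e⟩ := h'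
    exact ⟨a, ⟨b, d, c⟩, by linarith⟩

/-! ### The marginal is bounded and measurable; the `J`-integrand is integrable -/

/-- **`m` is bounded**: `|m(x,y)| ≤ (3/2)·sup|F|`. [folklore] -/
theorem exists_bound_mfun : ∃ C : ℝ, ∀ x y, |mfun x y| ≤ C := by
  obtain ⟨C, hC⟩ := exists_bound_F3
  refine ⟨C * (3 / 2), fun x y => ?_⟩
  unfold mfun
  have hsplit : Set.Ioi (0 : ℝ) = Set.Ioc 0 (3 / 2) ∪ Set.Ioi (3 / 2) :=
    (Set.Ioc_union_Ioi_eq_Ioi (by norm_num)).symm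
  rw [hsplit, setIntegral_union (Set.Ioc_disjoint_Ioi le_rfl) measurableSet_Ioi
    (integrable_fibre x y).integrableOn (integrable_fibre x y).integrableOn]
  have htail : ∫ u in Set.Ioi (3 / 2 : ℝ), F3 ![x, y, u] = 0 := by
    rw [setIntegral_congr_fun measurableSet_Ioi (g := fun _ => (0 : ℝ)) fun u hu => ?_]
    · simp
    · by_contra hne
      have := pos_of_F3_ne_zero hne
      simp only [Matrix.cons_val_zero, Matrix.cons_val_one, Matrix.cons_val_two, Matrix.head_cons,
        Matrix.tail_cons] at this
      obtain ⟨⟨h0, h1, -⟩, hs⟩ := this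
      have hu' : (3 / 2 : ℝ) < u := hu
      linarith
  rw [htail, add_zero]
  have key := norm_setIntegral_le_of_norm_le_const (μ := (volume : Measure ℝ)) (s := Set.Ioc (0 : ℝ) (3 / 2))
    measure_Ioc_lt_top (f := fun u => F3 ![x, y, u]) (C := C) fun u _ => by rw [Real.norm_eq_abs]; exact hC _
  rw [Real.norm_eq_abs, Real.volume_real_Ioc] at key
  convert key using 2
  norm_num

/-- **`m` is measurable** (as a function on `ℝ³` of the first two coordinates). [folklore] -/
theorem measurable_mfun_comp : Measurable fun t : Fin 3 → ℝ => mfun (t 0) (t 1) := by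
  have hH : Measurable (Function.uncurry fun (t : Fin 3 → ℝ) (u : ℝ) => F3 ![t 0, t 1, u]) := by
    refine measurable_F3.comp (measurable_pi_lambda _ fun k => ?_)
    fin_cases k
    · show Measurable fun c : (Fin 3 → ℝ) × ℝ => c.1 0
      exact (measurable_pi_apply 0).comp measurable_fst
    · show Measurable fun c : (Fin 3 → ℝ) × ℝ => c.1 1
      exact (measurable_pi_apply 1).comp measurable_fst
    · show Measurable fun c : (Fin 3 → ℝ) × ℝ => c.2
      exact measurable_snd
  have := MeasureTheory.StronglyMeasurable.integral_prod_right (ν := volume.restrict (Set.Ioi (0 : ℝ)))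
    hH.stronglyMeasurable
  exact this.measurable

/-- **The `J`-integrand `1_{J-region} · m²` is integrable on `ℝ³`.** [folklore] -/
theorem integrable_Jintegrand (r : ℝ) :
    Integrable ((polymathJRegion 3 r 2).indicator fun t : Fin 3 → ℝ => mfun (t 0) (t 1) ^ 2) := by
  obtain ⟨C, hC⟩ := exists_bound_mfun
  set K : Set (Fin 3 → ℝ) := Set.pi Set.univ fun _ => Set.Icc 0 (max 1 r) with hK
  have hKc : IsCompact K := isCompact_univ_pi fun _ => isCompact_Icc
  have hsub : polymathJRegion 3 r 2 ⊆ K := by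
    intro t ht
    rw [mem_polymathJRegion_two] at ht
    obtain ⟨a, ⟨b, c, d⟩, e⟩ := ht
    simp only [hK, Set.mem_univ_pi, Set.mem_Icc]
    intro k
    fin_cases k
    · exact ⟨b, by simp; right; linarith⟩
    · exact ⟨c, by simp; right; linarith⟩
    · exact ⟨d, by simp; left; exact a⟩
  rw [integrable_indicator_iff (PolymathCert.measurableSet_polymathJRegion 3 r 2)]
  refine Measure.integrableOn_of_bounded (M := C ^ 2) ((measure_mono hsub).trans_lt hKc.measure_lt_top).ne
    ((measurable_mfun_comp.pow_const 2).aestronglyMeasurable) ?_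
  refine Filter.Eventually.of_forall fun t => ?_
  rw [Real.norm_eq_abs, abs_pow]
  exact pow_le_pow_left₀ (abs_nonneg _) (hC _ _) 2
/-! ### The eight boxes `Q_m × (0,1)` and their exact integrals `J_m` (p. 33) -/

/-- The box `Q_1 × (0, 1)` (outer `x`, middle `y`, inner the dummy coordinate of `J_{3,1-ε}`).
[cite: Polymath8b2014, Section 7.4] -/
def box1 : GCell := ⟨0, 0, 0, (1/4), ⟨0, 0⟩, ⟨0, 1⟩, ⟨0, 0, 0⟩, ⟨1, 0, 0⟩⟩

/-- `box1` is well formed. [folklore] -/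
theorem box1_wf : box1.wf = true := by decide +kernel

/-- Membership in `box1`, unfolded. [folklore] -/
theorem mem_box1 (c : Bool) (t : Fin 3 → ℝ) : t ∈ box1.set c ↔
    (rel c ((0 : ℚ) : ℝ) (t 0) ∧ rel c (t 0) ((1/4 : ℚ) : ℝ)) ∧
    (rel c (((0 : ℚ) : ℝ) + ((0 : ℚ) : ℝ) * t 0) (t 1) ∧ rel c (t 1) (((0 : ℚ) : ℝ) + ((1 : ℚ) : ℝ) * t 0)) ∧
    (rel c (((0 : ℚ) : ℝ) + ((0 : ℚ) : ℝ) * t 0 + ((0 : ℚ) : ℝ) * t 1) (t 2) ∧ rel c (t 2) (((1 : ℚ) : ℝ) + ((0 : ℚ) : ℝ) * t 0 + ((0 : ℚ) : ℝ) * t 1)) := Iff.rfl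

/-- The integrand of `box1` is `M_{Q1}(x, y)²`. [folklore] -/
theorem integrand_box1 (t : Fin 3 → ℝ) : box1.integrand [ops2.mul MQ1 MQ1] t = ev2 (t 0) (t 1) MQ1 ^ 2 := by
  show leval (ev2 (t 0) (t 1)) [ops2.mul MQ1 MQ1] (t 2) = _
  rw [leval_cons, leval_nil, (lawful2 _ _).mul]
  ring

/-- **`J_1 = 10130397648257/475634073600`** (exact, kernel-evaluated). [cite: Polymath8b2014, Section 7.4] -/
theorem integral_box1 : box1.integral [ops2.mul MQ1 MQ1] = 10130397648257 / 475634073600 := by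
  decide +kernel

/-- The box `Q_2 × (0, 1)` (outer `x`, middle `y`, inner the dummy coordinate of `J_{3,1-ε}`).
[cite: Polymath8b2014, Section 7.4] -/
def box2 : GCell := ⟨0, 0, (1/4), (3/8), ⟨(1/4), 0⟩, ⟨0, 1⟩, ⟨0, 0, 0⟩, ⟨1, 0, 0⟩⟩

/-- `box2` is well formed. [folklore] -/
theorem box2_wf : box2.wf = true := by decide +kernel

/-- Membership in `box2`, unfolded. [folklore] -/
theorem mem_box2 (c : Bool) (t : Fin 3 → ℝ) : t ∈ box2.set c ↔
    (rel c ((1/4 : ℚ) : ℝ) (t 0) ∧ rel c (t 0) ((3/8 : ℚ) : ℝ)) ∧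
    (rel c (((1/4 : ℚ) : ℝ) + ((0 : ℚ) : ℝ) * t 0) (t 1) ∧ rel c (t 1) (((0 : ℚ) : ℝ) + ((1 : ℚ) : ℝ) * t 0)) ∧
    (rel c (((0 : ℚ) : ℝ) + ((0 : ℚ) : ℝ) * t 0 + ((0 : ℚ) : ℝ) * t 1) (t 2) ∧ rel c (t 2) (((1 : ℚ) : ℝ) + ((0 : ℚ) : ℝ) * t 0 + ((0 : ℚ) : ℝ) * t 1)) := Iff.rfl

/-- The integrand of `box2` is `M_{Q2}(x, y)²`. [folklore] -/
theorem integrand_box2 (t : Fin 3 → ℝ) : box2.integrand [ops2.mul MQ2 MQ2] t = ev2 (t 0) (t 1) MQ2 ^ 2 := by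
  show leval (ev2 (t 0) (t 1)) [ops2.mul MQ2 MQ2] (t 2) = _
  rw [leval_cons, leval_nil, (lawful2 _ _).mul]
  ring

/-- **`J_2 = 149584284132641/162349763788800`** (exact, kernel-evaluated). [cite: Polymath8b2014, Section 7.4] -/
theorem integral_box2 : box2.integral [ops2.mul MQ2 MQ2] = 149584284132641 / 162349763788800 := by
  decide +kernel

/-- The box `Q_3 × (0, 1)` (outer `x`, middle `y`, inner the dummy coordinate of `J_{3,1-ε}`).
[cite: Polymath8b2014, Section 7.4] -/
def box3 : GCell := ⟨0, 0, (1/4), (3/8), ⟨0, 0⟩, ⟨(1/4), 0⟩, ⟨0, 0, 0⟩, ⟨1, 0, 0⟩⟩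

/-- `box3` is well formed. [folklore] -/
theorem box3_wf : box3.wf = true := by decide +kernel

/-- Membership in `box3`, unfolded. [folklore] -/
theorem mem_box3 (c : Bool) (t : Fin 3 → ℝ) : t ∈ box3.set c ↔
    (rel c ((1/4 : ℚ) : ℝ) (t 0) ∧ rel c (t 0) ((3/8 : ℚ) : ℝ)) ∧
    (rel c (((0 : ℚ) : ℝ) + ((0 : ℚ) : ℝ) * t 0) (t 1) ∧ rel c (t 1) (((1/4 : ℚ) : ℝ) + ((0 : ℚ) : ℝ) * t 0)) ∧
    (rel c (((0 : ℚ) : ℝ) + ((0 : ℚ) : ℝ) * t 0 + ((0 : ℚ) : ℝ) * t 1) (t 2) ∧ rel c (t 2) (((1 : ℚ) : ℝ) + ((0 : ℚ) : ℝ) * t 0 + ((0 : ℚ) : ℝ) * t 1)) := Iff.rfl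

/-- The integrand of `box3` is `M_{Q3}(x, y)²`. [folklore] -/
theorem integrand_box3 (t : Fin 3 → ℝ) : box3.integrand [ops2.mul MQ3 MQ3] t = ev2 (t 0) (t 1) MQ3 ^ 2 := by
  show leval (ev2 (t 0) (t 1)) [ops2.mul MQ3 MQ3] (t 2) = _
  rw [leval_cons, leval_nil, (lawful2 _ _).mul]
  ring

/-- **`J_3 = 425262243958849/48704929136640`** (exact, kernel-evaluated). [cite: Polymath8b2014, Section 7.4] -/
theorem integral_box3 : box3.integral [ops2.mul MQ3 MQ3] = 425262243958849 / 48704929136640 := by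
  decide +kernel

/-- The box `Q_4 × (0, 1)` (outer `x`, middle `y`, inner the dummy coordinate of `J_{3,1-ε}`).
[cite: Polymath8b2014, Section 7.4] -/
def box4 : GCell := ⟨0, 0, (3/8), (1/2), ⟨(1/4), 0⟩, ⟨(3/4), (-1)⟩, ⟨0, 0, 0⟩, ⟨1, 0, 0⟩⟩

/-- `box4` is well formed. [folklore] -/
theorem box4_wf : box4.wf = true := by decide +kernel

/-- Membership in `box4`, unfolded. [folklore] -/
theorem mem_box4 (c : Bool) (t : Fin 3 → ℝ) : t ∈ box4.set c ↔
    (rel c ((3/8 : ℚ) : ℝ) (t 0) ∧ rel c (t 0) ((1/2 : ℚ) : ℝ)) ∧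
    (rel c (((1/4 : ℚ) : ℝ) + ((0 : ℚ) : ℝ) * t 0) (t 1) ∧ rel c (t 1) (((3/4 : ℚ) : ℝ) + ((-1 : ℚ) : ℝ) * t 0)) ∧
    (rel c (((0 : ℚ) : ℝ) + ((0 : ℚ) : ℝ) * t 0 + ((0 : ℚ) : ℝ) * t 1) (t 2) ∧ rel c (t 2) (((1 : ℚ) : ℝ) + ((0 : ℚ) : ℝ) * t 0 + ((0 : ℚ) : ℝ) * t 1)) := Iff.rfl

/-- The integrand of `box4` is `M_{Q4}(x, y)²`. [folklore] -/
theorem integrand_box4 (t : Fin 3 → ℝ) : box4.integrand [ops2.mul MQ4 MQ4] t = ev2 (t 0) (t 1) MQ4 ^ 2 := by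
  show leval (ev2 (t 0) (t 1)) [ops2.mul MQ4 MQ4] (t 2) = _
  rw [leval_cons, leval_nil, (lawful2 _ _).mul]
  ring

/-- **`J_4 = 290494683274669/487049291366400`** (exact, kernel-evaluated). [cite: Polymath8b2014, Section 7.4] -/
theorem integral_box4 : box4.integral [ops2.mul MQ4 MQ4] = 290494683274669 / 487049291366400 := by
  decide +kernel

/-- The box `Q_5 × (0, 1)` (outer `x`, middle `y`, inner the dummy coordinate of `J_{3,1-ε}`).
[cite: Polymath8b2014, Section 7.4] -/
def box5 : GCell := ⟨0, 0, (3/8), (1/2), ⟨0, 0⟩, ⟨(1/4), 0⟩, ⟨0, 0, 0⟩, ⟨1, 0, 0⟩⟩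

/-- `box5` is well formed. [folklore] -/
theorem box5_wf : box5.wf = true := by decide +kernel

/-- Membership in `box5`, unfolded. [folklore] -/
theorem mem_box5 (c : Bool) (t : Fin 3 → ℝ) : t ∈ box5.set c ↔
    (rel c ((3/8 : ℚ) : ℝ) (t 0) ∧ rel c (t 0) ((1/2 : ℚ) : ℝ)) ∧
    (rel c (((0 : ℚ) : ℝ) + ((0 : ℚ) : ℝ) * t 0) (t 1) ∧ rel c (t 1) (((1/4 : ℚ) : ℝ) + ((0 : ℚ) : ℝ) * t 0)) ∧
    (rel c (((0 : ℚ) : ℝ) + ((0 : ℚ) : ℝ) * t 0 + ((0 : ℚ) : ℝ) * t 1) (t 2) ∧ rel c (t 2) (((1 : ℚ) : ℝ) + ((0 : ℚ) : ℝ) * t 0 + ((0 : ℚ) : ℝ) * t 1)) := Iff.rfl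

/-- The integrand of `box5` is `M_{Q5}(x, y)²`. [folklore] -/
theorem integrand_box5 (t : Fin 3 → ℝ) : box5.integrand [ops2.mul MQ5 MQ5] t = ev2 (t 0) (t 1) MQ5 ^ 2 := by
  show leval (ev2 (t 0) (t 1)) [ops2.mul MQ5 MQ5] (t 2) = _
  rw [leval_cons, leval_nil, (lawful2 _ _).mul]
  ring

/-- **`J_5 = 1288430621443171/243524645683200`** (exact, kernel-evaluated). [cite: Polymath8b2014, Section 7.4] -/
theorem integral_box5 : box5.integral [ops2.mul MQ5 MQ5] = 1288430621443171 / 243524645683200 := by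
  decide +kernel

/-- The box `Q_6 × (0, 1)` (outer `x`, middle `y`, inner the dummy coordinate of `J_{3,1-ε}`).
[cite: Polymath8b2014, Section 7.4] -/
def box6 : GCell := ⟨0, 0, (1/2), (5/8), ⟨(-1/2), 1⟩, ⟨(3/4), (-1)⟩, ⟨0, 0, 0⟩, ⟨1, 0, 0⟩⟩

/-- `box6` is well formed. [folklore] -/
theorem box6_wf : box6.wf = true := by decide +kernel

/-- Membership in `box6`, unfolded. [folklore] -/
theorem mem_box6 (c : Bool) (t : Fin 3 → ℝ) : t ∈ box6.set c ↔
    (rel c ((1/2 : ℚ) : ℝ) (t 0) ∧ rel c (t 0) ((5/8 : ℚ) : ℝ)) ∧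
    (rel c (((-1/2 : ℚ) : ℝ) + ((1 : ℚ) : ℝ) * t 0) (t 1) ∧ rel c (t 1) (((3/4 : ℚ) : ℝ) + ((-1 : ℚ) : ℝ) * t 0)) ∧
    (rel c (((0 : ℚ) : ℝ) + ((0 : ℚ) : ℝ) * t 0 + ((0 : ℚ) : ℝ) * t 1) (t 2) ∧ rel c (t 2) (((1 : ℚ) : ℝ) + ((0 : ℚ) : ℝ) * t 0 + ((0 : ℚ) : ℝ) * t 1)) := Iff.rfl

/-- The integrand of `box6` is `M_{Q6}(x, y)²`. [folklore] -/
theorem integrand_box6 (t : Fin 3 → ℝ) : box6.integrand [ops2.mul MQ6 MQ6] t = ev2 (t 0) (t 1) MQ6 ^ 2 := by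
  show leval (ev2 (t 0) (t 1)) [ops2.mul MQ6 MQ6] (t 2) = _
  rw [leval_cons, leval_nil, (lawful2 _ _).mul]
  ring

/-- **`J_6 = 52624275963671/30440580710400`** (exact, kernel-evaluated). [cite: Polymath8b2014, Section 7.4] -/
theorem integral_box6 : box6.integral [ops2.mul MQ6 MQ6] = 52624275963671 / 30440580710400 := by
  decide +kernel

/-- The box `Q_7 × (0, 1)` (outer `x`, middle `y`, inner the dummy coordinate of `J_{3,1-ε}`).
[cite: Polymath8b2014, Section 7.4] -/
def box7 : GCell := ⟨0, 0, (1/2), (5/8), ⟨0, 0⟩, ⟨(-1/2), 1⟩, ⟨0, 0, 0⟩, ⟨1, 0, 0⟩⟩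

/-- `box7` is well formed. [folklore] -/
theorem box7_wf : box7.wf = true := by decide +kernel

/-- Membership in `box7`, unfolded. [folklore] -/
theorem mem_box7 (c : Bool) (t : Fin 3 → ℝ) : t ∈ box7.set c ↔
    (rel c ((1/2 : ℚ) : ℝ) (t 0) ∧ rel c (t 0) ((5/8 : ℚ) : ℝ)) ∧
    (rel c (((0 : ℚ) : ℝ) + ((0 : ℚ) : ℝ) * t 0) (t 1) ∧ rel c (t 1) (((-1/2 : ℚ) : ℝ) + ((1 : ℚ) : ℝ) * t 0)) ∧
    (rel c (((0 : ℚ) : ℝ) + ((0 : ℚ) : ℝ) * t 0 + ((0 : ℚ) : ℝ) * t 1) (t 2) ∧ rel c (t 2) (((1 : ℚ) : ℝ) + ((0 : ℚ) : ℝ) * t 0 + ((0 : ℚ) : ℝ) * t 1)) := Iff.rfl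

/-- The integrand of `box7` is `M_{Q7}(x, y)²`. [folklore] -/
theorem integrand_box7 (t : Fin 3 → ℝ) : box7.integrand [ops2.mul MQ7 MQ7] t = ev2 (t 0) (t 1) MQ7 ^ 2 := by
  show leval (ev2 (t 0) (t 1)) [ops2.mul MQ7 MQ7] (t 2) = _
  rw [leval_cons, leval_nil, (lawful2 _ _).mul]
  ring

/-- **`J_7 = 38357488495051/30440580710400`** (exact, kernel-evaluated). [cite: Polymath8b2014, Section 7.4] -/
theorem integral_box7 : box7.integral [ops2.mul MQ7 MQ7] = 38357488495051 / 30440580710400 := by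
  decide +kernel

/-- The box `Q_8 × (0, 1)` (outer `x`, middle `y`, inner the dummy coordinate of `J_{3,1-ε}`).
[cite: Polymath8b2014, Section 7.4] -/
def box8 : GCell := ⟨0, 0, (5/8), (3/4), ⟨0, 0⟩, ⟨(3/4), (-1)⟩, ⟨0, 0, 0⟩, ⟨1, 0, 0⟩⟩

/-- `box8` is well formed. [folklore] -/
theorem box8_wf : box8.wf = true := by decide +kernel

/-- Membership in `box8`, unfolded. [folklore] -/
theorem mem_box8 (c : Bool) (t : Fin 3 → ℝ) : t ∈ box8.set c ↔
    (rel c ((5/8 : ℚ) : ℝ) (t 0) ∧ rel c (t 0) ((3/4 : ℚ) : ℝ)) ∧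
    (rel c (((0 : ℚ) : ℝ) + ((0 : ℚ) : ℝ) * t 0) (t 1) ∧ rel c (t 1) (((3/4 : ℚ) : ℝ) + ((-1 : ℚ) : ℝ) * t 0)) ∧
    (rel c (((0 : ℚ) : ℝ) + ((0 : ℚ) : ℝ) * t 0 + ((0 : ℚ) : ℝ) * t 1) (t 2) ∧ rel c (t 2) (((1 : ℚ) : ℝ) + ((0 : ℚ) : ℝ) * t 0 + ((0 : ℚ) : ℝ) * t 1)) := Iff.rfl

/-- The integrand of `box8` is `M_{Q8}(x, y)²`. [folklore] -/
theorem integrand_box8 (t : Fin 3 → ℝ) : box8.integrand [ops2.mul MQ8 MQ8] t = ev2 (t 0) (t 1) MQ8 ^ 2 := by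
  show leval (ev2 (t 0) (t 1)) [ops2.mul MQ8 MQ8] (t 2) = _
  rw [leval_cons, leval_nil, (lawful2 _ _).mul]
  ring

/-- **`J_8 = 234207344275661/243524645683200`** (exact, kernel-evaluated). [cite: Polymath8b2014, Section 7.4] -/
theorem integral_box8 : box8.integral [ops2.mul MQ8 MQ8] = 234207344275661 / 243524645683200 := by
  decide +kernel

/-- Inside the open `box1`: the fibre identity `m = M_{Q1}` applies, the point lies in the
`J`-region and below the diagonal. [folklore] -/
theorem box1_spec {t : Fin 3 → ℝ} (h : t ∈ box1.set false) :
    mfun (t 0) (t 1) = ev2 (t 0) (t 1) MQ1 ∧ t ∈ polymathJRegion 3 (3 / 4) 2 ∧ t 1 < t 0 := by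
  rw [mem_box1] at h
  simp only [rel, Bool.false_eq_true, ↓reduceIte] at h
  push_cast at h
  obtain ⟨⟨h1, h2⟩, ⟨h3, h4⟩, ⟨h5, h6⟩⟩ := h
  refine ⟨mfun_Q1 (by linarith) (by linarith) (by linarith) (by linarith), ?_, by linarith⟩
  rw [mem_polymathJRegion_two]
  refine ⟨by linarith, ⟨by linarith, by linarith, by linarith⟩, by linarith⟩

/-- Inside the open `box2`: the fibre identity `m = M_{Q2}` applies, the point lies in the
`J`-region and below the diagonal. [folklore] -/
theorem box2_spec {t : Fin 3 → ℝ} (h : t ∈ box2.set false) :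
    mfun (t 0) (t 1) = ev2 (t 0) (t 1) MQ2 ∧ t ∈ polymathJRegion 3 (3 / 4) 2 ∧ t 1 < t 0 := by
  rw [mem_box2] at h
  simp only [rel, Bool.false_eq_true, ↓reduceIte] at h
  push_cast at h
  obtain ⟨⟨h1, h2⟩, ⟨h3, h4⟩, ⟨h5, h6⟩⟩ := h
  refine ⟨mfun_Q2 (by linarith) (by linarith) (by linarith) (by linarith), ?_, by linarith⟩
  rw [mem_polymathJRegion_two]
  refine ⟨by linarith, ⟨by linarith, by linarith, by linarith⟩, by linarith⟩

/-- Inside the open `box3`: the fibre identity `m = M_{Q3}` applies, the point lies in the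
`J`-region and below the diagonal. [folklore] -/
theorem box3_spec {t : Fin 3 → ℝ} (h : t ∈ box3.set false) :
    mfun (t 0) (t 1) = ev2 (t 0) (t 1) MQ3 ∧ t ∈ polymathJRegion 3 (3 / 4) 2 ∧ t 1 < t 0 := by
  rw [mem_box3] at h
  simp only [rel, Bool.false_eq_true, ↓reduceIte] at h
  push_cast at h
  obtain ⟨⟨h1, h2⟩, ⟨h3, h4⟩, ⟨h5, h6⟩⟩ := h
  refine ⟨mfun_Q3 (by linarith) (by linarith) (by linarith) (by linarith), ?_, by linarith⟩
  rw [mem_polymathJRegion_two]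
  refine ⟨by linarith, ⟨by linarith, by linarith, by linarith⟩, by linarith⟩

/-- Inside the open `box4`: the fibre identity `m = M_{Q4}` applies, the point lies in the
`J`-region and below the diagonal. [folklore] -/
theorem box4_spec {t : Fin 3 → ℝ} (h : t ∈ box4.set false) :
    mfun (t 0) (t 1) = ev2 (t 0) (t 1) MQ4 ∧ t ∈ polymathJRegion 3 (3 / 4) 2 ∧ t 1 < t 0 := by
  rw [mem_box4] at h
  simp only [rel, Bool.false_eq_true, ↓reduceIte] at h
  push_cast at h
  obtain ⟨⟨h1, h2⟩, ⟨h3, h4⟩, ⟨h5, h6⟩⟩ := h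
  refine ⟨mfun_Q4 (by linarith) (by linarith) (by linarith) (by linarith), ?_, by linarith⟩
  rw [mem_polymathJRegion_two]
  refine ⟨by linarith, ⟨by linarith, by linarith, by linarith⟩, by linarith⟩

/-- Inside the open `box5`: the fibre identity `m = M_{Q5}` applies, the point lies in the
`J`-region and below the diagonal. [folklore] -/
theorem box5_spec {t : Fin 3 → ℝ} (h : t ∈ box5.set false) :
    mfun (t 0) (t 1) = ev2 (t 0) (t 1) MQ5 ∧ t ∈ polymathJRegion 3 (3 / 4) 2 ∧ t 1 < t 0 := by
  rw [mem_box5] at h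
  simp only [rel, Bool.false_eq_true, ↓reduceIte] at h
  push_cast at h
  obtain ⟨⟨h1, h2⟩, ⟨h3, h4⟩, ⟨h5, h6⟩⟩ := h
  refine ⟨mfun_Q5 (by linarith) (by linarith) (by linarith) (by linarith), ?_, by linarith⟩
  rw [mem_polymathJRegion_two]
  refine ⟨by linarith, ⟨by linarith, by linarith, by linarith⟩, by linarith⟩

/-- Inside the open `box6`: the fibre identity `m = M_{Q6}` applies, the point lies in the
`J`-region and below the diagonal. [folklore] -/
theorem box6_spec {t : Fin 3 → ℝ} (h : t ∈ box6.set false) :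
    mfun (t 0) (t 1) = ev2 (t 0) (t 1) MQ6 ∧ t ∈ polymathJRegion 3 (3 / 4) 2 ∧ t 1 < t 0 := by
  rw [mem_box6] at h
  simp only [rel, Bool.false_eq_true, ↓reduceIte] at h
  push_cast at h
  obtain ⟨⟨h1, h2⟩, ⟨h3, h4⟩, ⟨h5, h6⟩⟩ := h
  refine ⟨mfun_Q6 (by linarith) (by linarith) (by linarith) (by linarith), ?_, by linarith⟩
  rw [mem_polymathJRegion_two]
  refine ⟨by linarith, ⟨by linarith, by linarith, by linarith⟩, by linarith⟩

/-- Inside the open `box7`: the fibre identity `m = M_{Q7}` applies, the point lies in the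
`J`-region and below the diagonal. [folklore] -/
theorem box7_spec {t : Fin 3 → ℝ} (h : t ∈ box7.set false) :
    mfun (t 0) (t 1) = ev2 (t 0) (t 1) MQ7 ∧ t ∈ polymathJRegion 3 (3 / 4) 2 ∧ t 1 < t 0 := by
  rw [mem_box7] at h
  simp only [rel, Bool.false_eq_true, ↓reduceIte] at h
  push_cast at h
  obtain ⟨⟨h1, h2⟩, ⟨h3, h4⟩, ⟨h5, h6⟩⟩ := h
  refine ⟨mfun_Q7 (by linarith) (by linarith) (by linarith) (by linarith), ?_, by linarith⟩
  rw [mem_polymathJRegion_two]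
  refine ⟨by linarith, ⟨by linarith, by linarith, by linarith⟩, by linarith⟩

/-- Inside the open `box8`: the fibre identity `m = M_{Q8}` applies, the point lies in the
`J`-region and below the diagonal. [folklore] -/
theorem box8_spec {t : Fin 3 → ℝ} (h : t ∈ box8.set false) :
    mfun (t 0) (t 1) = ev2 (t 0) (t 1) MQ8 ∧ t ∈ polymathJRegion 3 (3 / 4) 2 ∧ t 1 < t 0 := by
  rw [mem_box8] at h
  simp only [rel, Bool.false_eq_true, ↓reduceIte] at h
  push_cast at h
  obtain ⟨⟨h1, h2⟩, ⟨h3, h4⟩, ⟨h5, h6⟩⟩ := h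
  refine ⟨mfun_Q8 (by linarith) (by linarith) (by linarith) (by linarith), ?_, by linarith⟩
  rw [mem_polymathJRegion_two]
  refine ⟨by linarith, ⟨by linarith, by linarith, by linarith⟩, by linarith⟩

/-- The open boxes `box1`, `box2` are disjoint. [folklore] -/
theorem not_mem_box2_of_mem_box1 {t : Fin 3 → ℝ} (h : t ∈ box1.set false) : t ∉ box2.set false := fun h' => by
  rw [mem_box1] at h
  rw [mem_box2] at h'
  simp only [rel, Bool.false_eq_true, ↓reduceIte] at h h'
  push_cast at h h'
  obtain ⟨⟨h1, h2⟩, ⟨h3, h4⟩, -⟩ := h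
  obtain ⟨⟨g1, g2⟩, ⟨g3, g4⟩, -⟩ := h'
  linarith

/-- The open boxes `box1`, `box3` are disjoint. [folklore] -/
theorem not_mem_box3_of_mem_box1 {t : Fin 3 → ℝ} (h : t ∈ box1.set false) : t ∉ box3.set false := fun h' => by
  rw [mem_box1] at h
  rw [mem_box3] at h'
  simp only [rel, Bool.false_eq_true, ↓reduceIte] at h h'
  push_cast at h h'
  obtain ⟨⟨h1, h2⟩, ⟨h3, h4⟩, -⟩ := h
  obtain ⟨⟨g1, g2⟩, ⟨g3, g4⟩, -⟩ := h'
  linarith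

/-- The open boxes `box1`, `box4` are disjoint. [folklore] -/
theorem not_mem_box4_of_mem_box1 {t : Fin 3 → ℝ} (h : t ∈ box1.set false) : t ∉ box4.set false := fun h' => by
  rw [mem_box1] at h
  rw [mem_box4] at h'
  simp only [rel, Bool.false_eq_true, ↓reduceIte] at h h'
  push_cast at h h'
  obtain ⟨⟨h1, h2⟩, ⟨h3, h4⟩, -⟩ := h
  obtain ⟨⟨g1, g2⟩, ⟨g3, g4⟩, -⟩ := h'
  linarith

/-- The open boxes `box1`, `box5` are disjoint. [folklore] -/
theorem not_mem_box5_of_mem_box1 {t : Fin 3 → ℝ} (h : t ∈ box1.set false) : t ∉ box5.set false := fun h' => by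
  rw [mem_box1] at h
  rw [mem_box5] at h'
  simp only [rel, Bool.false_eq_true, ↓reduceIte] at h h'
  push_cast at h h'
  obtain ⟨⟨h1, h2⟩, ⟨h3, h4⟩, -⟩ := h
  obtain ⟨⟨g1, g2⟩, ⟨g3, g4⟩, -⟩ := h'
  linarith

/-- The open boxes `box1`, `box6` are disjoint. [folklore] -/
theorem not_mem_box6_of_mem_box1 {t : Fin 3 → ℝ} (h : t ∈ box1.set false) : t ∉ box6.set false := fun h' => by
  rw [mem_box1] at h
  rw [mem_box6] at h'
  simp only [rel, Bool.false_eq_true, ↓reduceIte] at h h'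
  push_cast at h h'
  obtain ⟨⟨h1, h2⟩, ⟨h3, h4⟩, -⟩ := h
  obtain ⟨⟨g1, g2⟩, ⟨g3, g4⟩, -⟩ := h'
  linarith

/-- The open boxes `box1`, `box7` are disjoint. [folklore] -/
theorem not_mem_box7_of_mem_box1 {t : Fin 3 → ℝ} (h : t ∈ box1.set false) : t ∉ box7.set false := fun h' => by
  rw [mem_box1] at h
  rw [mem_box7] at h'
  simp only [rel, Bool.false_eq_true, ↓reduceIte] at h h'
  push_cast at h h'
  obtain ⟨⟨h1, h2⟩, ⟨h3, h4⟩, -⟩ := h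
  obtain ⟨⟨g1, g2⟩, ⟨g3, g4⟩, -⟩ := h'
  linarith

/-- The open boxes `box1`, `box8` are disjoint. [folklore] -/
theorem not_mem_box8_of_mem_box1 {t : Fin 3 → ℝ} (h : t ∈ box1.set false) : t ∉ box8.set false := fun h' => by
  rw [mem_box1] at h
  rw [mem_box8] at h'
  simp only [rel, Bool.false_eq_true, ↓reduceIte] at h h'
  push_cast at h h'
  obtain ⟨⟨h1, h2⟩, ⟨h3, h4⟩, -⟩ := h
  obtain ⟨⟨g1, g2⟩, ⟨g3, g4⟩, -⟩ := h'
  linarith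

/-- The open boxes `box2`, `box3` are disjoint. [folklore] -/
theorem not_mem_box3_of_mem_box2 {t : Fin 3 → ℝ} (h : t ∈ box2.set false) : t ∉ box3.set false := fun h' => by
  rw [mem_box2] at h
  rw [mem_box3] at h'
  simp only [rel, Bool.false_eq_true, ↓reduceIte] at h h'
  push_cast at h h'
  obtain ⟨⟨h1, h2⟩, ⟨h3, h4⟩, -⟩ := h
  obtain ⟨⟨g1, g2⟩, ⟨g3, g4⟩, -⟩ := h'
  linarith

/-- The open boxes `box2`, `box4` are disjoint. [folklore] -/
theorem not_mem_box4_of_mem_box2 {t : Fin 3 → ℝ} (h : t ∈ box2.set false) : t ∉ box4.set false := fun h' => by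
  rw [mem_box2] at h
  rw [mem_box4] at h'
  simp only [rel, Bool.false_eq_true, ↓reduceIte] at h h'
  push_cast at h h'
  obtain ⟨⟨h1, h2⟩, ⟨h3, h4⟩, -⟩ := h
  obtain ⟨⟨g1, g2⟩, ⟨g3, g4⟩, -⟩ := h'
  linarith

/-- The open boxes `box2`, `box5` are disjoint. [folklore] -/
theorem not_mem_box5_of_mem_box2 {t : Fin 3 → ℝ} (h : t ∈ box2.set false) : t ∉ box5.set false := fun h' => by
  rw [mem_box2] at h
  rw [mem_box5] at h'
  simp only [rel, Bool.false_eq_true, ↓reduceIte] at h h'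
  push_cast at h h'
  obtain ⟨⟨h1, h2⟩, ⟨h3, h4⟩, -⟩ := h
  obtain ⟨⟨g1, g2⟩, ⟨g3, g4⟩, -⟩ := h'
  linarith

/-- The open boxes `box2`, `box6` are disjoint. [folklore] -/
theorem not_mem_box6_of_mem_box2 {t : Fin 3 → ℝ} (h : t ∈ box2.set false) : t ∉ box6.set false := fun h' => by
  rw [mem_box2] at h
  rw [mem_box6] at h'
  simp only [rel, Bool.false_eq_true, ↓reduceIte] at h h'
  push_cast at h h'
  obtain ⟨⟨h1, h2⟩, ⟨h3, h4⟩, -⟩ := h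
  obtain ⟨⟨g1, g2⟩, ⟨g3, g4⟩, -⟩ := h'
  linarith

/-- The open boxes `box2`, `box7` are disjoint. [folklore] -/
theorem not_mem_box7_of_mem_box2 {t : Fin 3 → ℝ} (h : t ∈ box2.set false) : t ∉ box7.set false := fun h' => by
  rw [mem_box2] at h
  rw [mem_box7] at h'
  simp only [rel, Bool.false_eq_true, ↓reduceIte] at h h'
  push_cast at h h'
  obtain ⟨⟨h1, h2⟩, ⟨h3, h4⟩, -⟩ := h
  obtain ⟨⟨g1, g2⟩, ⟨g3, g4⟩, -⟩ := h'
  linarith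

/-- The open boxes `box2`, `box8` are disjoint. [folklore] -/
theorem not_mem_box8_of_mem_box2 {t : Fin 3 → ℝ} (h : t ∈ box2.set false) : t ∉ box8.set false := fun h' => by
  rw [mem_box2] at h
  rw [mem_box8] at h'
  simp only [rel, Bool.false_eq_true, ↓reduceIte] at h h'
  push_cast at h h'
  obtain ⟨⟨h1, h2⟩, ⟨h3, h4⟩, -⟩ := h
  obtain ⟨⟨g1, g2⟩, ⟨g3, g4⟩, -⟩ := h'
  linarith

/-- The open boxes `box3`, `box4` are disjoint. [folklore] -/
theorem not_mem_box4_of_mem_box3 {t : Fin 3 → ℝ} (h : t ∈ box3.set false) : t ∉ box4.set false := fun h' => by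
  rw [mem_box3] at h
  rw [mem_box4] at h'
  simp only [rel, Bool.false_eq_true, ↓reduceIte] at h h'
  push_cast at h h'
  obtain ⟨⟨h1, h2⟩, ⟨h3, h4⟩, -⟩ := h
  obtain ⟨⟨g1, g2⟩, ⟨g3, g4⟩, -⟩ := h'
  linarith

/-- The open boxes `box3`, `box5` are disjoint. [folklore] -/
theorem not_mem_box5_of_mem_box3 {t : Fin 3 → ℝ} (h : t ∈ box3.set false) : t ∉ box5.set false := fun h' => by
  rw [mem_box3] at h
  rw [mem_box5] at h'
  simp only [rel, Bool.false_eq_true, ↓reduceIte] at h h'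
  push_cast at h h'
  obtain ⟨⟨h1, h2⟩, ⟨h3, h4⟩, -⟩ := h
  obtain ⟨⟨g1, g2⟩, ⟨g3, g4⟩, -⟩ := h'
  linarith

/-- The open boxes `box3`, `box6` are disjoint. [folklore] -/
theorem not_mem_box6_of_mem_box3 {t : Fin 3 → ℝ} (h : t ∈ box3.set false) : t ∉ box6.set false := fun h' => by
  rw [mem_box3] at h
  rw [mem_box6] at h'
  simp only [rel, Bool.false_eq_true, ↓reduceIte] at h h'
  push_cast at h h'
  obtain ⟨⟨h1, h2⟩, ⟨h3, h4⟩, -⟩ := h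
  obtain ⟨⟨g1, g2⟩, ⟨g3, g4⟩, -⟩ := h'
  linarith

/-- The open boxes `box3`, `box7` are disjoint. [folklore] -/
theorem not_mem_box7_of_mem_box3 {t : Fin 3 → ℝ} (h : t ∈ box3.set false) : t ∉ box7.set false := fun h' => by
  rw [mem_box3] at h
  rw [mem_box7] at h'
  simp only [rel, Bool.false_eq_true, ↓reduceIte] at h h'
  push_cast at h h'
  obtain ⟨⟨h1, h2⟩, ⟨h3, h4⟩, -⟩ := h
  obtain ⟨⟨g1, g2⟩, ⟨g3, g4⟩, -⟩ := h'
  linarith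

/-- The open boxes `box3`, `box8` are disjoint. [folklore] -/
theorem not_mem_box8_of_mem_box3 {t : Fin 3 → ℝ} (h : t ∈ box3.set false) : t ∉ box8.set false := fun h' => by
  rw [mem_box3] at h
  rw [mem_box8] at h'
  simp only [rel, Bool.false_eq_true, ↓reduceIte] at h h'
  push_cast at h h'
  obtain ⟨⟨h1, h2⟩, ⟨h3, h4⟩, -⟩ := h
  obtain ⟨⟨g1, g2⟩, ⟨g3, g4⟩, -⟩ := h'
  linarith

/-- The open boxes `box4`, `box5` are disjoint. [folklore] -/
theorem not_mem_box5_of_mem_box4 {t : Fin 3 → ℝ} (h : t ∈ box4.set false) : t ∉ box5.set false := fun h' => by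
  rw [mem_box4] at h
  rw [mem_box5] at h'
  simp only [rel, Bool.false_eq_true, ↓reduceIte] at h h'
  push_cast at h h'
  obtain ⟨⟨h1, h2⟩, ⟨h3, h4⟩, -⟩ := h
  obtain ⟨⟨g1, g2⟩, ⟨g3, g4⟩, -⟩ := h'
  linarith

/-- The open boxes `box4`, `box6` are disjoint. [folklore] -/
theorem not_mem_box6_of_mem_box4 {t : Fin 3 → ℝ} (h : t ∈ box4.set false) : t ∉ box6.set false := fun h' => by
  rw [mem_box4] at h
  rw [mem_box6] at h'
  simp only [rel, Bool.false_eq_true, ↓reduceIte] at h h'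
  push_cast at h h'
  obtain ⟨⟨h1, h2⟩, ⟨h3, h4⟩, -⟩ := h
  obtain ⟨⟨g1, g2⟩, ⟨g3, g4⟩, -⟩ := h'
  linarith

/-- The open boxes `box4`, `box7` are disjoint. [folklore] -/
theorem not_mem_box7_of_mem_box4 {t : Fin 3 → ℝ} (h : t ∈ box4.set false) : t ∉ box7.set false := fun h' => by
  rw [mem_box4] at h
  rw [mem_box7] at h'
  simp only [rel, Bool.false_eq_true, ↓reduceIte] at h h'
  push_cast at h h'
  obtain ⟨⟨h1, h2⟩, ⟨h3, h4⟩, -⟩ := h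
  obtain ⟨⟨g1, g2⟩, ⟨g3, g4⟩, -⟩ := h'
  linarith

/-- The open boxes `box4`, `box8` are disjoint. [folklore] -/
theorem not_mem_box8_of_mem_box4 {t : Fin 3 → ℝ} (h : t ∈ box4.set false) : t ∉ box8.set false := fun h' => by
  rw [mem_box4] at h
  rw [mem_box8] at h'
  simp only [rel, Bool.false_eq_true, ↓reduceIte] at h h'
  push_cast at h h'
  obtain ⟨⟨h1, h2⟩, ⟨h3, h4⟩, -⟩ := h
  obtain ⟨⟨g1, g2⟩, ⟨g3, g4⟩, -⟩ := h'
  linarith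

/-- The open boxes `box5`, `box6` are disjoint. [folklore] -/
theorem not_mem_box6_of_mem_box5 {t : Fin 3 → ℝ} (h : t ∈ box5.set false) : t ∉ box6.set false := fun h' => by
  rw [mem_box5] at h
  rw [mem_box6] at h'
  simp only [rel, Bool.false_eq_true, ↓reduceIte] at h h'
  push_cast at h h'
  obtain ⟨⟨h1, h2⟩, ⟨h3, h4⟩, -⟩ := h
  obtain ⟨⟨g1, g2⟩, ⟨g3, g4⟩, -⟩ := h'
  linarith

/-- The open boxes `box5`, `box7` are disjoint. [folklore] -/
theorem not_mem_box7_of_mem_box5 {t : Fin 3 → ℝ} (h : t ∈ box5.set false) : t ∉ box7.set false := fun h' => by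
  rw [mem_box5] at h
  rw [mem_box7] at h'
  simp only [rel, Bool.false_eq_true, ↓reduceIte] at h h'
  push_cast at h h'
  obtain ⟨⟨h1, h2⟩, ⟨h3, h4⟩, -⟩ := h
  obtain ⟨⟨g1, g2⟩, ⟨g3, g4⟩, -⟩ := h'
  linarith

/-- The open boxes `box5`, `box8` are disjoint. [folklore] -/
theorem not_mem_box8_of_mem_box5 {t : Fin 3 → ℝ} (h : t ∈ box5.set false) : t ∉ box8.set false := fun h' => by
  rw [mem_box5] at h
  rw [mem_box8] at h'
  simp only [rel, Bool.false_eq_true, ↓reduceIte] at h h'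
  push_cast at h h'
  obtain ⟨⟨h1, h2⟩, ⟨h3, h4⟩, -⟩ := h
  obtain ⟨⟨g1, g2⟩, ⟨g3, g4⟩, -⟩ := h'
  linarith

/-- The open boxes `box6`, `box7` are disjoint. [folklore] -/
theorem not_mem_box7_of_mem_box6 {t : Fin 3 → ℝ} (h : t ∈ box6.set false) : t ∉ box7.set false := fun h' => by
  rw [mem_box6] at h
  rw [mem_box7] at h'
  simp only [rel, Bool.false_eq_true, ↓reduceIte] at h h'
  push_cast at h h'
  obtain ⟨⟨h1, h2⟩, ⟨h3, h4⟩, -⟩ := h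
  obtain ⟨⟨g1, g2⟩, ⟨g3, g4⟩, -⟩ := h'
  linarith

/-- The open boxes `box6`, `box8` are disjoint. [folklore] -/
theorem not_mem_box8_of_mem_box6 {t : Fin 3 → ℝ} (h : t ∈ box6.set false) : t ∉ box8.set false := fun h' => by
  rw [mem_box6] at h
  rw [mem_box8] at h'
  simp only [rel, Bool.false_eq_true, ↓reduceIte] at h h'
  push_cast at h h'
  obtain ⟨⟨h1, h2⟩, ⟨h3, h4⟩, -⟩ := h
  obtain ⟨⟨g1, g2⟩, ⟨g3, g4⟩, -⟩ := h'
  linarith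

/-- The open boxes `box7`, `box8` are disjoint. [folklore] -/
theorem not_mem_box8_of_mem_box7 {t : Fin 3 → ℝ} (h : t ∈ box7.set false) : t ∉ box8.set false := fun h' => by
  rw [mem_box7] at h
  rw [mem_box8] at h'
  simp only [rel, Bool.false_eq_true, ↓reduceIte] at h h'
  push_cast at h h'
  obtain ⟨⟨h1, h2⟩, ⟨h3, h4⟩, -⟩ := h
  obtain ⟨⟨g1, g2⟩, ⟨g3, g4⟩, -⟩ := h'
  linarith
/-! ### The lower-bound function built from the eight boxes -/

/-- `ℓ = Σ_m 1_{box_m} · M_{Q_m}²` (a minorant of the `J`-integrand below the diagonal). [folklore] -/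
def ell (t : Fin 3 → ℝ) : ℝ :=
  (box1.set false).indicator (box1.integrand [ops2.mul MQ1 MQ1]) t +
  (box2.set false).indicator (box2.integrand [ops2.mul MQ2 MQ2]) t +
  (box3.set false).indicator (box3.integrand [ops2.mul MQ3 MQ3]) t +
  (box4.set false).indicator (box4.integrand [ops2.mul MQ4 MQ4]) t +
  (box5.set false).indicator (box5.integrand [ops2.mul MQ5 MQ5]) t +
  (box6.set false).indicator (box6.integrand [ops2.mul MQ6 MQ6]) t +
  (box7.set false).indicator (box7.integrand [ops2.mul MQ7 MQ7]) t +
  (box8.set false).indicator (box8.integrand [ops2.mul MQ8 MQ8]) t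

/-- `ℓ ≥ 0`. [folklore] -/
theorem ell_nonneg (t : Fin 3 → ℝ) : 0 ≤ ell t := by
  unfold ell
  have n : ∀ (c : GCell) (M : Q2), 0 ≤ (c.set false).indicator (c.integrand [ops2.mul M M]) t := by
    intro c M
    refine Set.indicator_nonneg (fun s _ => ?_) t
    show 0 ≤ leval (ev2 (s c.i) (s c.mid)) [ops2.mul M M] (s c.inn)
    rw [leval_cons, leval_nil, (lawful2 _ _).mul]
    nlinarith [sq_nonneg (ev2 (s c.i) (s c.mid) M)]
  have n1 := n box1 MQ1; have n2 := n box2 MQ2; have n3 := n box3 MQ3; have n4 := n box4 MQ4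
  have n5 := n box5 MQ5; have n6 := n box6 MQ6; have n7 := n box7 MQ7; have n8 := n box8 MQ8
  linarith

/-- `ℓ` on the open `box1`. [folklore] -/
theorem ell_eq_of_mem_box1 {t : Fin 3 → ℝ} (h : t ∈ box1.set false) : ell t = ev2 (t 0) (t 1) MQ1 ^ 2 := by
  unfold ell
  rw [Set.indicator_of_mem h, integrand_box1, Set.indicator_of_notMem (not_mem_box2_of_mem_box1 h), Set.indicator_of_notMem (not_mem_box3_of_mem_box1 h), Set.indicator_of_notMem (not_mem_box4_of_mem_box1 h), Set.indicator_of_notMem (not_mem_box5_of_mem_box1 h), Set.indicator_of_notMem (not_mem_box6_of_mem_box1 h), Set.indicator_of_notMem (not_mem_box7_of_mem_box1 h), Set.indicator_of_notMem (not_mem_box8_of_mem_box1 h)]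
  ring

/-- `ℓ` on the open `box2`. [folklore] -/
theorem ell_eq_of_mem_box2 {t : Fin 3 → ℝ} (h : t ∈ box2.set false) : ell t = ev2 (t 0) (t 1) MQ2 ^ 2 := by
  unfold ell
  rw [Set.indicator_of_mem h, integrand_box2, Set.indicator_of_notMem (fun h' => not_mem_box2_of_mem_box1 h' h), Set.indicator_of_notMem (not_mem_box3_of_mem_box2 h), Set.indicator_of_notMem (not_mem_box4_of_mem_box2 h), Set.indicator_of_notMem (not_mem_box5_of_mem_box2 h), Set.indicator_of_notMem (not_mem_box6_of_mem_box2 h), Set.indicator_of_notMem (not_mem_box7_of_mem_box2 h), Set.indicator_of_notMem (not_mem_box8_of_mem_box2 h)]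
  ring

/-- `ℓ` on the open `box3`. [folklore] -/
theorem ell_eq_of_mem_box3 {t : Fin 3 → ℝ} (h : t ∈ box3.set false) : ell t = ev2 (t 0) (t 1) MQ3 ^ 2 := by
  unfold ell
  rw [Set.indicator_of_mem h, integrand_box3, Set.indicator_of_notMem (fun h' => not_mem_box3_of_mem_box1 h' h), Set.indicator_of_notMem (fun h' => not_mem_box3_of_mem_box2 h' h), Set.indicator_of_notMem (not_mem_box4_of_mem_box3 h), Set.indicator_of_notMem (not_mem_box5_of_mem_box3 h), Set.indicator_of_notMem (not_mem_box6_of_mem_box3 h), Set.indicator_of_notMem (not_mem_box7_of_mem_box3 h), Set.indicator_of_notMem (not_mem_box8_of_mem_box3 h)]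
  ring

/-- `ℓ` on the open `box4`. [folklore] -/
theorem ell_eq_of_mem_box4 {t : Fin 3 → ℝ} (h : t ∈ box4.set false) : ell t = ev2 (t 0) (t 1) MQ4 ^ 2 := by
  unfold ell
  rw [Set.indicator_of_mem h, integrand_box4, Set.indicator_of_notMem (fun h' => not_mem_box4_of_mem_box1 h' h), Set.indicator_of_notMem (fun h' => not_mem_box4_of_mem_box2 h' h), Set.indicator_of_notMem (fun h' => not_mem_box4_of_mem_box3 h' h), Set.indicator_of_notMem (not_mem_box5_of_mem_box4 h), Set.indicator_of_notMem (not_mem_box6_of_mem_box4 h), Set.indicator_of_notMem (not_mem_box7_of_mem_box4 h), Set.indicator_of_notMem (not_mem_box8_of_mem_box4 h)]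
  ring

/-- `ℓ` on the open `box5`. [folklore] -/
theorem ell_eq_of_mem_box5 {t : Fin 3 → ℝ} (h : t ∈ box5.set false) : ell t = ev2 (t 0) (t 1) MQ5 ^ 2 := by
  unfold ell
  rw [Set.indicator_of_mem h, integrand_box5, Set.indicator_of_notMem (fun h' => not_mem_box5_of_mem_box1 h' h), Set.indicator_of_notMem (fun h' => not_mem_box5_of_mem_box2 h' h), Set.indicator_of_notMem (fun h' => not_mem_box5_of_mem_box3 h' h), Set.indicator_of_notMem (fun h' => not_mem_box5_of_mem_box4 h' h), Set.indicator_of_notMem (not_mem_box6_of_mem_box5 h), Set.indicator_of_notMem (not_mem_box7_of_mem_box5 h), Set.indicator_of_notMem (not_mem_box8_of_mem_box5 h)]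
  ring

/-- `ℓ` on the open `box6`. [folklore] -/
theorem ell_eq_of_mem_box6 {t : Fin 3 → ℝ} (h : t ∈ box6.set false) : ell t = ev2 (t 0) (t 1) MQ6 ^ 2 := by
  unfold ell
  rw [Set.indicator_of_mem h, integrand_box6, Set.indicator_of_notMem (fun h' => not_mem_box6_of_mem_box1 h' h), Set.indicator_of_notMem (fun h' => not_mem_box6_of_mem_box2 h' h), Set.indicator_of_notMem (fun h' => not_mem_box6_of_mem_box3 h' h), Set.indicator_of_notMem (fun h' => not_mem_box6_of_mem_box4 h' h), Set.indicator_of_notMem (fun h' => not_mem_box6_of_mem_box5 h' h), Set.indicator_of_notMem (not_mem_box7_of_mem_box6 h), Set.indicator_of_notMem (not_mem_box8_of_mem_box6 h)]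
  ring

/-- `ℓ` on the open `box7`. [folklore] -/
theorem ell_eq_of_mem_box7 {t : Fin 3 → ℝ} (h : t ∈ box7.set false) : ell t = ev2 (t 0) (t 1) MQ7 ^ 2 := by
  unfold ell
  rw [Set.indicator_of_mem h, integrand_box7, Set.indicator_of_notMem (fun h' => not_mem_box7_of_mem_box1 h' h), Set.indicator_of_notMem (fun h' => not_mem_box7_of_mem_box2 h' h), Set.indicator_of_notMem (fun h' => not_mem_box7_of_mem_box3 h' h), Set.indicator_of_notMem (fun h' => not_mem_box7_of_mem_box4 h' h), Set.indicator_of_notMem (fun h' => not_mem_box7_of_mem_box5 h' h), Set.indicator_of_notMem (fun h' => not_mem_box7_of_mem_box6 h' h), Set.indicator_of_notMem (not_mem_box8_of_mem_box7 h)]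
  ring

/-- `ℓ` on the open `box8`. [folklore] -/
theorem ell_eq_of_mem_box8 {t : Fin 3 → ℝ} (h : t ∈ box8.set false) : ell t = ev2 (t 0) (t 1) MQ8 ^ 2 := by
  unfold ell
  rw [Set.indicator_of_mem h, integrand_box8, Set.indicator_of_notMem (fun h' => not_mem_box8_of_mem_box1 h' h), Set.indicator_of_notMem (fun h' => not_mem_box8_of_mem_box2 h' h), Set.indicator_of_notMem (fun h' => not_mem_box8_of_mem_box3 h' h), Set.indicator_of_notMem (fun h' => not_mem_box8_of_mem_box4 h' h), Set.indicator_of_notMem (fun h' => not_mem_box8_of_mem_box5 h' h), Set.indicator_of_notMem (fun h' => not_mem_box8_of_mem_box6 h' h), Set.indicator_of_notMem (fun h' => not_mem_box8_of_mem_box7 h' h)]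
  ring

/-- `ℓ` vanishes off the boxes. [folklore] -/
theorem ell_eq_zero {t : Fin 3 → ℝ} (h1 : t ∉ box1.set false) (h2 : t ∉ box2.set false) (h3 : t ∉ box3.set false) (h4 : t ∉ box4.set false) (h5 : t ∉ box5.set false) (h6 : t ∉ box6.set false) (h7 : t ∉ box7.set false) (h8 : t ∉ box8.set false) : ell t = 0 := by
  unfold ell
  rw [Set.indicator_of_notMem h1, Set.indicator_of_notMem h2, Set.indicator_of_notMem h3, Set.indicator_of_notMem h4, Set.indicator_of_notMem h5, Set.indicator_of_notMem h6, Set.indicator_of_notMem h7, Set.indicator_of_notMem h8]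
  ring

/-- **Pointwise**: `ℓ(t) + ℓ(t₁, t₀, t₂) ≤ 1_{J-region}(t) · m(t₀, t₁)²`. [folklore] -/
theorem ell_add_ell_swap_le (t : Fin 3 → ℝ) :
    ell t + ell ![t 1, t 0, t 2] ≤ (polymathJRegion 3 (3 / 4) 2).indicator (fun t => mfun (t 0) (t 1) ^ 2) t := by
  have hnn : 0 ≤ (polymathJRegion 3 (3 / 4) 2).indicator (fun t : Fin 3 → ℝ => mfun (t 0) (t 1) ^ 2) t :=
    Set.indicator_nonneg (fun s _ => by positivity) t
  by_cases hA : t ∈ box1.set false ∨ t ∈ box2.set false ∨ t ∈ box3.set false ∨ t ∈ box4.set false ∨ t ∈ box5.set false ∨ t ∈ box6.set false ∨ t ∈ box7.set false ∨ t ∈ box8.set false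
  · -- `t` lies in a box: below the diagonal, so the swapped point lies in none
    have hlt : t 1 < t 0 := by
      rcases hA with h | h | h | h | h | h | h | h
      · exact (box1_spec h).2.2
      · exact (box2_spec h).2.2
      · exact (box3_spec h).2.2
      · exact (box4_spec h).2.2
      · exact (box5_spec h).2.2
      · exact (box6_spec h).2.2
      · exact (box7_spec h).2.2
      · exact (box8_spec h).2.2
    have hs : ell ![t 1, t 0, t 2] = 0 :=
      ell_eq_zero (fun h' => by
        have q := (box1_spec h').2.2
        simp only [Matrix.cons_val_zero, Matrix.cons_val_one] at q
        linarith) (fun h' => by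
        have q := (box2_spec h').2.2
        simp only [Matrix.cons_val_zero, Matrix.cons_val_one] at q
        linarith) (fun h' => by
        have q := (box3_spec h').2.2
        simp only [Matrix.cons_val_zero, Matrix.cons_val_one] at q
        linarith) (fun h' => by
        have q := (box4_spec h').2.2
        simp only [Matrix.cons_val_zero, Matrix.cons_val_one] at q
        linarith) (fun h' => by
        have q := (box5_spec h').2.2
        simp only [Matrix.cons_val_zero, Matrix.cons_val_one] at q
        linarith) (fun h' => by
        have q := (box6_spec h').2.2
        simp only [Matrix.cons_val_zero, Matrix.cons_val_one] at q
        linarith) (fun h' => by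
        have q := (box7_spec h').2.2
        simp only [Matrix.cons_val_zero, Matrix.cons_val_one] at q
        linarith) (fun h' => by
        have q := (box8_spec h').2.2
        simp only [Matrix.cons_val_zero, Matrix.cons_val_one] at q
        linarith)
    rw [hs, add_zero]
    rcases hA with h | h | h | h | h | h | h | h
    · obtain ⟨e, hmem, -⟩ := box1_spec h
      rw [ell_eq_of_mem_box1 h, Set.indicator_of_mem hmem, ← e]
    · obtain ⟨e, hmem, -⟩ := box2_spec h
      rw [ell_eq_of_mem_box2 h, Set.indicator_of_mem hmem, ← e]
    · obtain ⟨e, hmem, -⟩ := box3_spec h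
      rw [ell_eq_of_mem_box3 h, Set.indicator_of_mem hmem, ← e]
    · obtain ⟨e, hmem, -⟩ := box4_spec h
      rw [ell_eq_of_mem_box4 h, Set.indicator_of_mem hmem, ← e]
    · obtain ⟨e, hmem, -⟩ := box5_spec h
      rw [ell_eq_of_mem_box5 h, Set.indicator_of_mem hmem, ← e]
    · obtain ⟨e, hmem, -⟩ := box6_spec h
      rw [ell_eq_of_mem_box6 h, Set.indicator_of_mem hmem, ← e]
    · obtain ⟨e, hmem, -⟩ := box7_spec h
      rw [ell_eq_of_mem_box7 h, Set.indicator_of_mem hmem, ← e]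
    · obtain ⟨e, hmem, -⟩ := box8_spec h
      rw [ell_eq_of_mem_box8 h, Set.indicator_of_mem hmem, ← e]
  · have hA' := hA
    simp only [not_or] at hA'
    obtain ⟨a1, a2, a3, a4, a5, a6, a7, a8⟩ := hA'
    rw [ell_eq_zero a1 a2 a3 a4 a5 a6 a7 a8, zero_add]
    by_cases hB : ![t 1, t 0, t 2] ∈ box1.set false ∨ ![t 1, t 0, t 2] ∈ box2.set false ∨ ![t 1, t 0, t 2] ∈ box3.set false ∨ ![t 1, t 0, t 2] ∈ box4.set false ∨ ![t 1, t 0, t 2] ∈ box5.set false ∨ ![t 1, t 0, t 2] ∈ box6.set false ∨ ![t 1, t 0, t 2] ∈ box7.set false ∨ ![t 1, t 0, t 2] ∈ box8.set false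
    · rcases hB with h | h | h | h | h | h | h | h
      · obtain ⟨e, hmem, -⟩ := box1_spec h
        rw [ell_eq_of_mem_box1 h]
        simp only [Matrix.cons_val_zero, Matrix.cons_val_one] at e hmem ⊢
        rw [mem_polymathJRegion_two] at hmem
        simp only [Matrix.cons_val_zero, Matrix.cons_val_one, Matrix.cons_val_two, Matrix.head_cons,
          Matrix.tail_cons] at hmem
        obtain ⟨q1, ⟨q2, q3, q4⟩, q5⟩ := hmem
        rw [Set.indicator_of_mem (mem_polymathJRegion_two.2 ⟨q1, ⟨q3, q2, q4⟩, by linarith⟩), ← mfun_symm, ← e]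
      · obtain ⟨e, hmem, -⟩ := box2_spec h
        rw [ell_eq_of_mem_box2 h]
        simp only [Matrix.cons_val_zero, Matrix.cons_val_one] at e hmem ⊢
        rw [mem_polymathJRegion_two] at hmem
        simp only [Matrix.cons_val_zero, Matrix.cons_val_one, Matrix.cons_val_two, Matrix.head_cons,
          Matrix.tail_cons] at hmem
        obtain ⟨q1, ⟨q2, q3, q4⟩, q5⟩ := hmem
        rw [Set.indicator_of_mem (mem_polymathJRegion_two.2 ⟨q1, ⟨q3, q2, q4⟩, by linarith⟩), ← mfun_symm, ← e]
      · obtain ⟨e, hmem, -⟩ := box3_spec h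
        rw [ell_eq_of_mem_box3 h]
        simp only [Matrix.cons_val_zero, Matrix.cons_val_one] at e hmem ⊢
        rw [mem_polymathJRegion_two] at hmem
        simp only [Matrix.cons_val_zero, Matrix.cons_val_one, Matrix.cons_val_two, Matrix.head_cons,
          Matrix.tail_cons] at hmem
        obtain ⟨q1, ⟨q2, q3, q4⟩, q5⟩ := hmem
        rw [Set.indicator_of_mem (mem_polymathJRegion_two.2 ⟨q1, ⟨q3, q2, q4⟩, by linarith⟩), ← mfun_symm, ← e]
      · obtain ⟨e, hmem, -⟩ := box4_spec h
        rw [ell_eq_of_mem_box4 h]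
        simp only [Matrix.cons_val_zero, Matrix.cons_val_one] at e hmem ⊢
        rw [mem_polymathJRegion_two] at hmem
        simp only [Matrix.cons_val_zero, Matrix.cons_val_one, Matrix.cons_val_two, Matrix.head_cons,
          Matrix.tail_cons] at hmem
        obtain ⟨q1, ⟨q2, q3, q4⟩, q5⟩ := hmem
        rw [Set.indicator_of_mem (mem_polymathJRegion_two.2 ⟨q1, ⟨q3, q2, q4⟩, by linarith⟩), ← mfun_symm, ← e]
      · obtain ⟨e, hmem, -⟩ := box5_spec h
        rw [ell_eq_of_mem_box5 h]
        simp only [Matrix.cons_val_zero, Matrix.cons_val_one] at e hmem ⊢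
        rw [mem_polymathJRegion_two] at hmem
        simp only [Matrix.cons_val_zero, Matrix.cons_val_one, Matrix.cons_val_two, Matrix.head_cons,
          Matrix.tail_cons] at hmem
        obtain ⟨q1, ⟨q2, q3, q4⟩, q5⟩ := hmem
        rw [Set.indicator_of_mem (mem_polymathJRegion_two.2 ⟨q1, ⟨q3, q2, q4⟩, by linarith⟩), ← mfun_symm, ← e]
      · obtain ⟨e, hmem, -⟩ := box6_spec h
        rw [ell_eq_of_mem_box6 h]
        simp only [Matrix.cons_val_zero, Matrix.cons_val_one] at e hmem ⊢
        rw [mem_polymathJRegion_two] at hmem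
        simp only [Matrix.cons_val_zero, Matrix.cons_val_one, Matrix.cons_val_two, Matrix.head_cons,
          Matrix.tail_cons] at hmem
        obtain ⟨q1, ⟨q2, q3, q4⟩, q5⟩ := hmem
        rw [Set.indicator_of_mem (mem_polymathJRegion_two.2 ⟨q1, ⟨q3, q2, q4⟩, by linarith⟩), ← mfun_symm, ← e]
      · obtain ⟨e, hmem, -⟩ := box7_spec h
        rw [ell_eq_of_mem_box7 h]
        simp only [Matrix.cons_val_zero, Matrix.cons_val_one] at e hmem ⊢
        rw [mem_polymathJRegion_two] at hmem
        simp only [Matrix.cons_val_zero, Matrix.cons_val_one, Matrix.cons_val_two, Matrix.head_cons,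
          Matrix.tail_cons] at hmem
        obtain ⟨q1, ⟨q2, q3, q4⟩, q5⟩ := hmem
        rw [Set.indicator_of_mem (mem_polymathJRegion_two.2 ⟨q1, ⟨q3, q2, q4⟩, by linarith⟩), ← mfun_symm, ← e]
      · obtain ⟨e, hmem, -⟩ := box8_spec h
        rw [ell_eq_of_mem_box8 h]
        simp only [Matrix.cons_val_zero, Matrix.cons_val_one] at e hmem ⊢
        rw [mem_polymathJRegion_two] at hmem
        simp only [Matrix.cons_val_zero, Matrix.cons_val_one, Matrix.cons_val_two, Matrix.head_cons,
          Matrix.tail_cons] at hmem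
        obtain ⟨q1, ⟨q2, q3, q4⟩, q5⟩ := hmem
        rw [Set.indicator_of_mem (mem_polymathJRegion_two.2 ⟨q1, ⟨q3, q2, q4⟩, by linarith⟩), ← mfun_symm, ← e]
    · simp only [not_or] at hB
      obtain ⟨b1, b2, b3, b4, b5, b6, b7, b8⟩ := hB
      rw [ell_eq_zero b1 b2 b3 b4 b5 b6 b7 b8]
      exact hnn

/-- **`∫ ℓ = J₁ + ⋯ + J₈ = 9933190664926733/243524645683200`**. [cite: Polymath8b2014, Section 7.4] -/
theorem integral_ell : ∫ t, ell t = 9933190664926733 / 243524645683200 := by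
  have i1 : Integrable ((box1.set false).indicator (box1.integrand [ops2.mul MQ1 MQ1])) := box1.integrable_indicator false _
  have v1 : ∫ t, (box1.set false).indicator (box1.integrand [ops2.mul MQ1 MQ1]) t = (10130397648257 / 475634073600 : ℚ) := by
    rw [box1.integral_indicator_eq box1_wf, integral_box1]
  have i2 : Integrable ((box2.set false).indicator (box2.integrand [ops2.mul MQ2 MQ2])) := box2.integrable_indicator false _
  have v2 : ∫ t, (box2.set false).indicator (box2.integrand [ops2.mul MQ2 MQ2]) t = (149584284132641 / 162349763788800 : ℚ) := by
    rw [box2.integral_indicator_eq box2_wf, integral_box2]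
  have i3 : Integrable ((box3.set false).indicator (box3.integrand [ops2.mul MQ3 MQ3])) := box3.integrable_indicator false _
  have v3 : ∫ t, (box3.set false).indicator (box3.integrand [ops2.mul MQ3 MQ3]) t = (425262243958849 / 48704929136640 : ℚ) := by
    rw [box3.integral_indicator_eq box3_wf, integral_box3]
  have i4 : Integrable ((box4.set false).indicator (box4.integrand [ops2.mul MQ4 MQ4])) := box4.integrable_indicator false _
  have v4 : ∫ t, (box4.set false).indicator (box4.integrand [ops2.mul MQ4 MQ4]) t = (290494683274669 / 487049291366400 : ℚ) := by
    rw [box4.integral_indicator_eq box4_wf, integral_box4]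
  have i5 : Integrable ((box5.set false).indicator (box5.integrand [ops2.mul MQ5 MQ5])) := box5.integrable_indicator false _
  have v5 : ∫ t, (box5.set false).indicator (box5.integrand [ops2.mul MQ5 MQ5]) t = (1288430621443171 / 243524645683200 : ℚ) := by
    rw [box5.integral_indicator_eq box5_wf, integral_box5]
  have i6 : Integrable ((box6.set false).indicator (box6.integrand [ops2.mul MQ6 MQ6])) := box6.integrable_indicator false _
  have v6 : ∫ t, (box6.set false).indicator (box6.integrand [ops2.mul MQ6 MQ6]) t = (52624275963671 / 30440580710400 : ℚ) := by
    rw [box6.integral_indicator_eq box6_wf, integral_box6]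
  have i7 : Integrable ((box7.set false).indicator (box7.integrand [ops2.mul MQ7 MQ7])) := box7.integrable_indicator false _
  have v7 : ∫ t, (box7.set false).indicator (box7.integrand [ops2.mul MQ7 MQ7]) t = (38357488495051 / 30440580710400 : ℚ) := by
    rw [box7.integral_indicator_eq box7_wf, integral_box7]
  have i8 : Integrable ((box8.set false).indicator (box8.integrand [ops2.mul MQ8 MQ8])) := box8.integrable_indicator false _
  have v8 : ∫ t, (box8.set false).indicator (box8.integrand [ops2.mul MQ8 MQ8]) t = (234207344275661 / 243524645683200 : ℚ) := by
    rw [box8.integral_indicator_eq box8_wf, integral_box8]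
  have j1 : Integrable (fun t : Fin 3 → ℝ => (box1.set false).indicator (box1.integrand [ops2.mul MQ1 MQ1]) t) := i1
  have s2 : (∫ t : Fin 3 → ℝ, ((box1.set false).indicator (box1.integrand [ops2.mul MQ1 MQ1]) t + (box2.set false).indicator (box2.integrand [ops2.mul MQ2 MQ2]) t)) = (∫ t : Fin 3 → ℝ, ((box1.set false).indicator (box1.integrand [ops2.mul MQ1 MQ1]) t)) + ∫ t : Fin 3 → ℝ, (box2.set false).indicator (box2.integrand [ops2.mul MQ2 MQ2]) t :=
    integral_add j1 i2
  have j2 : Integrable (fun t : Fin 3 → ℝ => (box1.set false).indicator (box1.integrand [ops2.mul MQ1 MQ1]) t + (box2.set false).indicator (box2.integrand [ops2.mul MQ2 MQ2]) t) := j1.add i2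
  have s3 : (∫ t : Fin 3 → ℝ, ((box1.set false).indicator (box1.integrand [ops2.mul MQ1 MQ1]) t + (box2.set false).indicator (box2.integrand [ops2.mul MQ2 MQ2]) t + (box3.set false).indicator (box3.integrand [ops2.mul MQ3 MQ3]) t)) = (∫ t : Fin 3 → ℝ, ((box1.set false).indicator (box1.integrand [ops2.mul MQ1 MQ1]) t + (box2.set false).indicator (box2.integrand [ops2.mul MQ2 MQ2]) t)) + ∫ t : Fin 3 → ℝ, (box3.set false).indicator (box3.integrand [ops2.mul MQ3 MQ3]) t :=
    integral_add j2 i3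
  have j3 : Integrable (fun t : Fin 3 → ℝ => (box1.set false).indicator (box1.integrand [ops2.mul MQ1 MQ1]) t + (box2.set false).indicator (box2.integrand [ops2.mul MQ2 MQ2]) t + (box3.set false).indicator (box3.integrand [ops2.mul MQ3 MQ3]) t) := j2.add i3
  have s4 : (∫ t : Fin 3 → ℝ, ((box1.set false).indicator (box1.integrand [ops2.mul MQ1 MQ1]) t + (box2.set false).indicator (box2.integrand [ops2.mul MQ2 MQ2]) t + (box3.set false).indicator (box3.integrand [ops2.mul MQ3 MQ3]) t + (box4.set false).indicator (box4.integrand [ops2.mul MQ4 MQ4]) t)) = (∫ t : Fin 3 → ℝ, ((box1.set false).indicator (box1.integrand [ops2.mul MQ1 MQ1]) t + (box2.set false).indicator (box2.integrand [ops2.mul MQ2 MQ2]) t + (box3.set false).indicator (box3.integrand [ops2.mul MQ3 MQ3]) t)) + ∫ t : Fin 3 → ℝ, (box4.set false).indicator (box4.integrand [ops2.mul MQ4 MQ4]) t :=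
    integral_add j3 i4
  have j4 : Integrable (fun t : Fin 3 → ℝ => (box1.set false).indicator (box1.integrand [ops2.mul MQ1 MQ1]) t + (box2.set false).indicator (box2.integrand [ops2.mul MQ2 MQ2]) t + (box3.set false).indicator (box3.integrand [ops2.mul MQ3 MQ3]) t + (box4.set false).indicator (box4.integrand [ops2.mul MQ4 MQ4]) t) := j3.add i4
  have s5 : (∫ t : Fin 3 → ℝ, ((box1.set false).indicator (box1.integrand [ops2.mul MQ1 MQ1]) t + (box2.set false).indicator (box2.integrand [ops2.mul MQ2 MQ2]) t + (box3.set false).indicator (box3.integrand [ops2.mul MQ3 MQ3]) t + (box4.set false).indicator (box4.integrand [ops2.mul MQ4 MQ4]) t + (box5.set false).indicator (box5.integrand [ops2.mul MQ5 MQ5]) t)) = (∫ t : Fin 3 → ℝ, ((box1.set false).indicator (box1.integrand [ops2.mul MQ1 MQ1]) t + (box2.set false).indicator (box2.integrand [ops2.mul MQ2 MQ2]) t + (box3.set false).indicator (box3.integrand [ops2.mul MQ3 MQ3]) t + (box4.set false).indicator (box4.integrand [ops2.mul MQ4 MQ4]) t)) + ∫ t : Fin 3 → ℝ, (box5.set false).indicator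 (box5.integrand [ops2.mul MQ5 MQ5]) t :=
    integral_add j4 i5
  have j5 : Integrable (fun t : Fin 3 → ℝ => (box1.set false).indicator (box1.integrand [ops2.mul MQ1 MQ1]) t + (box2.set false).indicator (box2.integrand [ops2.mul MQ2 MQ2]) t + (box3.set false).indicator (box3.integrand [ops2.mul MQ3 MQ3]) t + (box4.set false).indicator (box4.integrand [ops2.mul MQ4 MQ4]) t + (box5.set false).indicator (box5.integrand [ops2.mul MQ5 MQ5]) t) := j4.add i5
  have s6 : (∫ t : Fin 3 → ℝ, ((box1.set false).indicator (box1.integrand [ops2.mul MQ1 MQ1]) t + (box2.set false).indicator (box2.integrand [ops2.mul MQ2 MQ2]) t + (box3.set false).indicator (box3.integrand [ops2.mul MQ3 MQ3]) t + (box4.set false).indicator (box4.integrand [ops2.mul MQ4 MQ4]) t + (box5.set false).indicator (box5.integrand [ops2.mul MQ5 MQ5]) t + (box6.set false).indicator (box6.integrand [ops2.mul MQ6 MQ6]) t)) = (∫ t : Fin 3 → ℝ, ((box1.set false).indicator (box1.integrand [ops2.mul MQ1 MQ1]) t + (box2.set false).indicator (box2.integrand [ops2.mul MQ2 MQ2])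 t + (box3.set false).indicator (box3.integrand [ops2.mul MQ3 MQ3]) t + (box4.set false).indicator (box4.integrand [ops2.mul MQ4 MQ4]) t + (box5.set false).indicator (box5.integrand [ops2.mul MQ5 MQ5]) t)) + ∫ t : Fin 3 → ℝ, (box6.set false).indicator (box6.integrand [ops2.mul MQ6 MQ6]) t :=
    integral_add j5 i6
  have j6 : Integrable (fun t : Fin 3 → ℝ => (box1.set false).indicator (box1.integrand [ops2.mul MQ1 MQ1]) t + (box2.set false).indicator (box2.integrand [ops2.mul MQ2 MQ2]) t + (box3.set false).indicator (box3.integrand [ops2.mul MQ3 MQ3]) t + (box4.set false).indicator (box4.integrand [ops2.mul MQ4 MQ4]) t + (box5.set false).indicator (box5.integrand [ops2.mul MQ5 MQ5]) t + (box6.set false).indicator (box6.integrand [ops2.mul MQ6 MQ6]) t) := j5.add i6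
  have s7 : (∫ t : Fin 3 → ℝ, ((box1.set false).indicator (box1.integrand [ops2.mul MQ1 MQ1]) t + (box2.set false).indicator (box2.integrand [ops2.mul MQ2 MQ2]) t + (box3.set false).indicator (box3.integrand [ops2.mul MQ3 MQ3]) t + (box4.set false).indicator (box4.integrand [ops2.mul MQ4 MQ4]) t + (box5.set false).indicator (box5.integrand [ops2.mul MQ5 MQ5]) t + (box6.set false).indicator (box6.integrand [ops2.mul MQ6 MQ6]) t + (box7.set false).indicator (box7.integrand [ops2.mul MQ7 MQ7]) t)) = (∫ t : Fin 3 → ℝ, ((box1.set false).indicator (box1.integrand [ops2.mul MQ1 MQ1]) t + (box2.set false).indicator (box2.integrand [ops2.mul MQ2 MQ2]) t + (box3.set false).indicator (box3.integrand [ops2.mul MQ3 MQ3]) t + (box4.set false).indicator (box4.integrand [ops2.mul MQ4 MQ4]) t + (box5.set false).indicator (box5.integrand [ops2.mul MQ5 MQ5]) t + (box6.set false).indicator (box6.integrand [ops2.mul MQ6 MQ6]) t)) + ∫ t : Fin 3 → ℝ, (box7.set false).indicator (box7.integrand [ops2.mul MQ7 MQ7]) t :=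
    integral_add j6 i7
  have j7 : Integrable (fun t : Fin 3 → ℝ => (box1.set false).indicator (box1.integrand [ops2.mul MQ1 MQ1]) t + (box2.set false).indicator (box2.integrand [ops2.mul MQ2 MQ2]) t + (box3.set false).indicator (box3.integrand [ops2.mul MQ3 MQ3]) t + (box4.set false).indicator (box4.integrand [ops2.mul MQ4 MQ4]) t + (box5.set false).indicator (box5.integrand [ops2.mul MQ5 MQ5]) t + (box6.set false).indicator (box6.integrand [ops2.mul MQ6 MQ6]) t + (box7.set false).indicator (box7.integrand [ops2.mul MQ7 MQ7]) t) := j6.add i7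
  have s8 : (∫ t : Fin 3 → ℝ, ((box1.set false).indicator (box1.integrand [ops2.mul MQ1 MQ1]) t + (box2.set false).indicator (box2.integrand [ops2.mul MQ2 MQ2]) t + (box3.set false).indicator (box3.integrand [ops2.mul MQ3 MQ3]) t + (box4.set false).indicator (box4.integrand [ops2.mul MQ4 MQ4]) t + (box5.set false).indicator (box5.integrand [ops2.mul MQ5 MQ5]) t + (box6.set false).indicator (box6.integrand [ops2.mul MQ6 MQ6]) t + (box7.set false).indicator (box7.integrand [ops2.mul MQ7 MQ7]) t + (box8.set false).indicator (box8.integrand [ops2.mul MQ8 MQ8]) t)) = (∫ t : Fin 3 → ℝ, ((box1.set false).indicator (box1.integrand [ops2.mul MQ1 MQ1]) t + (box2.set false).indicator (box2.integrand [ops2.mul MQ2 MQ2]) t + (box3.set false).indicator (box3.integrand [ops2.mul MQ3 MQ3]) t + (box4.set false).indicator (box4.integrand [ops2.mul MQ4 MQ4]) t + (box5.set false).indicator (box5.integrand [ops2.mul MQ5 MQ5]) t + (box6.set false).indicator (box6.integrand [ops2.mul MQ6 MQ6]) t + (box7.set false).indicator (box7.integrand [ops2.mul MQ7 MQ7]) t))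 + ∫ t : Fin 3 → ℝ, (box8.set false).indicator (box8.integrand [ops2.mul MQ8 MQ8]) t :=
    integral_add j7 i8
  unfold ell
  rw [s8, s7, s6, s5, s4, s3, s2, v1, v2, v3, v4, v5, v6, v7, v8]
  norm_num

/-! ### Assembly: `Σ_i J_{i,3/4}(F) ≥ 9933190664926733/40587440947200 = J(F)` -/

/-- Composing with a permutation of the coordinates preserves integrability on `ℝ³`. [folklore] -/
theorem integrable_comp_perm (σ : Equiv.Perm (Fin 3)) {g : (Fin 3 → ℝ) → ℝ} (hg : Integrable g) :
    Integrable fun t : Fin 3 → ℝ => g (fun k => t (σ k)) := by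
  have h := (volume_measurePreserving_piCongrLeft (fun _ : Fin 3 => ℝ) σ).symm
  exact (h.integrable_comp hg.aestronglyMeasurable).2 hg

/-- `ℓ` is integrable. [folklore] -/
theorem integrable_ell : Integrable ell := by
  have i1 : Integrable ((box1.set false).indicator (box1.integrand [ops2.mul MQ1 MQ1])) := box1.integrable_indicator false _
  have i2 : Integrable ((box2.set false).indicator (box2.integrand [ops2.mul MQ2 MQ2])) := box2.integrable_indicator false _
  have i3 : Integrable ((box3.set false).indicator (box3.integrand [ops2.mul MQ3 MQ3])) := box3.integrable_indicator false _
  have i4 : Integrable ((box4.set false).indicator (box4.integrand [ops2.mul MQ4 MQ4])) := box4.integrable_indicator false _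
  have i5 : Integrable ((box5.set false).indicator (box5.integrand [ops2.mul MQ5 MQ5])) := box5.integrable_indicator false _
  have i6 : Integrable ((box6.set false).indicator (box6.integrand [ops2.mul MQ6 MQ6])) := box6.integrable_indicator false _
  have i7 : Integrable ((box7.set false).indicator (box7.integrand [ops2.mul MQ7 MQ7])) := box7.integrable_indicator false _
  have i8 : Integrable ((box8.set false).indicator (box8.integrand [ops2.mul MQ8 MQ8])) := box8.integrable_indicator false _
  have : ell = fun t => ((box1.set false).indicator (box1.integrand [ops2.mul MQ1 MQ1]) t +
      (box2.set false).indicator (box2.integrand [ops2.mul MQ2 MQ2]) t +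
      (box3.set false).indicator (box3.integrand [ops2.mul MQ3 MQ3]) t +
      (box4.set false).indicator (box4.integrand [ops2.mul MQ4 MQ4]) t +
      (box5.set false).indicator (box5.integrand [ops2.mul MQ5 MQ5]) t +
      (box6.set false).indicator (box6.integrand [ops2.mul MQ6 MQ6]) t +
      (box7.set false).indicator (box7.integrand [ops2.mul MQ7 MQ7]) t +
      (box8.set false).indicator (box8.integrand [ops2.mul MQ8 MQ8]) t) := by
    funext t; rfl
  rw [this]
  exact ((((((i1.add i2).add i3).add i4).add i5).add i6).add i7).add i8

/-- **`J_{3,3/4}(F) ≥ 2 (J₁ + ⋯ + J₈)`** (the display `J(F) = 6(J₁ + ⋯ + J₈)` of p. 33 in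
lower-bound form: the open boxes and their mirror images are disjoint subsets of the region of
integration, on which the integrand is `M_{Q_m}²`). [cite: Polymath8b2014, Section 7.4] -/
theorem polymathJ_two_ge : 2 * (9933190664926733 / 243524645683200 : ℝ) ≤ polymathJ 3 (3 / 4) 2 F3 := by
  rw [polymathJ_two_eq]
  have hswap : ∫ t : Fin 3 → ℝ, ell ![t 1, t 0, t 2] = ∫ t, ell t := by
    have key := integral_comp_perm (Equiv.swap 0 1) ell
    have hfun : (fun t : Fin 3 → ℝ => ell fun k => t (Equiv.swap 0 1 k)) = fun t => ell ![t 1, t 0, t 2] :=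
      funext fun t => by rw [rearr_102]
    rw [hfun] at key
    exact key
  have hint : Integrable fun t : Fin 3 → ℝ => ell ![t 1, t 0, t 2] := by
    have := integrable_comp_perm (Equiv.swap 0 1) integrable_ell
    have hfun : (fun t : Fin 3 → ℝ => ell fun k => t (Equiv.swap 0 1 k)) = fun t => ell ![t 1, t 0, t 2] :=
      funext fun t => by rw [rearr_102]
    rw [hfun] at this
    exact this
  have hsum : ∫ t : Fin 3 → ℝ, (ell t + ell ![t 1, t 0, t 2]) = 2 * (9933190664926733 / 243524645683200 : ℝ) := by
    rw [integral_add integrable_ell hint, hswap, integral_ell]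
    ring
  rw [← hsum]
  exact integral_mono_of_nonneg (Filter.Eventually.of_forall fun t => add_nonneg (ell_nonneg t) (ell_nonneg _))
    (integrable_Jintegrand (3 / 4)) (Filter.Eventually.of_forall ell_add_ell_swap_le)

/-- **Polymath 8b, §7.4: `Σ_{i} J_{i,1-ε}(F) ≥ J(F) = 9933190664926733/40587440947200`** for the cutoff
`F = F3` and `ε = 1/4` ("`J(F) = 9933190664926733/40587440947200`", p. 34; here `J(F) = 3 J_{3,3/4}(F)`
and the three `J_i` agree by symmetry).  Stated as a lower bound, which is what Theorem 3.15 needs.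
[cite: Polymath8b2014, Section 7.4] -/
theorem sum_polymathJ_ge :
    (9933190664926733 / 40587440947200 : ℝ) ≤ ∑ i : Fin 3, polymathJ 3 (3 / 4) i F3 := by
  rw [Fin.sum_univ_three, polymathJ_zero_eq, polymathJ_one_eq, ← polymathJ_two_eq]
  have := polymathJ_two_ge
  linarith

/-- **Theorem 3.15, the inequality**: `Σ_i J_{i,1-ε}(F) > 2 I(F)` for `F = F3`, `ε = 1/4`, i.e.
`J(F)/I(F) = 2 + 286648173/4966595189139280 > 2` (p. 34). [cite: Polymath8b2014, Theorem 3.15] -/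
theorem two_mul_polymathI_lt_sum_polymathJ :
    2 * polymathI 3 F3 < ∑ i : Fin 3, polymathJ 3 (1 - 1 / 4) i F3 := by
  rw [show (1 - 1 / 4 : ℝ) = 3 / 4 by norm_num, polymathI_F3]
  have := sum_polymathJ_ge
  have gap : 2 * (62082439864241 / 507343011840 : ℝ) < 9933190664926733 / 40587440947200 := by norm_num
  linarith

end GEHCutoff

end Literature.NumberTheory.Sieve
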